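import Literature.MathematicalPhysics.QuantumFieldTheory.Balaban1983to89.B4Thm112RegionAllF
import Literature.MathematicalPhysics.QuantumFieldTheory.Balaban1983to89.B4Thm19RegionUnifK
import Literature.MathematicalPhysics.QuantumFieldTheory.Balaban1983to89.B4Thm112RegionHolderUnifK
import Literature.MathematicalPhysics.QuantumFieldTheory.Balaban1983to89.B4Ineq111ZeroNestEta
import Literature.MathematicalPhysics.QuantumFieldTheory.Balaban1983to89.B4Thm112BoxValue

/-!
# `Balaban1983to89.B4ThmRegionPairEta` — [Balaban1983RegularityDecay] THEOREM p. 573, (1.9)–(1.12), ON THE FAMILY OF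
# GENERAL PAIRS `Ω ⊂ Ω₀` OF FINITE UNIONS OF BIG BLOCKS AT A (1.7)-REGULAR FIELD, IN THE TYPED `η`-UNIFORM FORM
# `ThmPrintedNN` (`∀ α ∃ (δ₀, c₀, R₀, e₁) ∀ instances`) — the printed generality (p. 572 «We consider subsets Ω
# which are unions of big blocks.», p. 573 «If Ω ⊂ Ω₀»), with the printed restriction `dist(·, Ω^c) ≥ R₀` LIVE
# (`rect := False`)

statement-level skeleton of published theorems with citation tags; proofs where landed; nothing here is a claim about the Yang–Mills mass gap

CITATION HEADER.  T. Bałaban, *Regularity and decay of lattice Green's functions*, Commun. Math. Phys. **89** (1983)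
571–597, doi:10.1007/bf01214744 [Balaban1983RegularityDecay] (cell paper B4; held text
`paper:balaban1983-cmp89-regularity-decay`, journal page = PDF page + 570; p. 573 Theorem (1.9)–(1.12), p. 572 (1.1)–(1.7), p. 577 (2.15), p. 580 Cor. 2.3 (2.30)).
Unit `lit-balaban-r01` gen 8 (B4 fold owner; HOME `run/shared/lean/pub/lit-balaban/`), SKELETON row **B4.Thm@573**
(file 4 of the r01 g8 programme).  Imports: r01 g8 `B4Thm112RegionAllF` (δG derivative member for an arbitrary `f`;
→ r04 g8 `B4Thm110RegionAllF`: (1.10) value/derivative and δG value members for an arbitrary `f`, → r01 g7's region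
theorems), r01 g8 `B4Thm19RegionUnifK` / `B4Thm112RegionHolderUnifK` (the Hölder members with the block size before
`α`), pv17 `B4Ineq111ZeroNestEta` (the typed target `ThmPrintedNN` over b04's `B4.EtaSetting` / `Ineq19_110` /
`Ineq111_112`), p17 `B4Thm112BoxValue` (site-norm helpers).

WHAT IS PRINTED.  p. 573 [PDF 3], verbatim: «Theorem (Proposition 2.1 of [1]). For α < 1 there exist positive
constants δ₀, c₀, R₀ independent of A, k, Ω and depending on d, M only, c₀ on α also, such that for e sufficiently small
and for an arbitrary function f : Ω → R^N, we have [(1.9)] for x, x′ ∈ Ω, and satisfying the condition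
dist({x, x′}, Ω^c) ≥ R₀. Similarly [(1.10)] for x ∈ Ω, dist(x, Ω^c) ≥ R₀. If Ω ⊂ Ω₀, then for δG_k(Ω, Ω₀, A) defined by
the equality δG_k(Ω, Ω₀, A) = G_k(Ω, A) − G_k(Ω₀, A), (1.11) we have the inequalities (1.5) and (1.6) (with the same
restrictions on x, x′) with the additional factor [(1.12)] on the right hand sides. For some simple sets Ω, e.g. for
rectangular parallelepipeds, the inequalities hold without any restrictions on the points x, x′, i.e. for all
x, x′ ∈ Ω.» (the in-text «(1.5) and (1.6)» is the print's +4 cross-reference slip for (1.9) and (1.10), cell GAPS.md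
G-B4-r01-1); the standing hypotheses are on p. 572 [PDF 2], verbatim: «We consider subsets Ω which are unions of big
blocks.» and «We consider all these operators under the assumption that the vector field A is regular on Ω in the sense
that [(1.7)]»; p. 573: «The constant γ₀ is independent of the lattice spacing η, as well as of Ω and of A.» (said of
(1.8)).  PARAPHRASE (not a quotation): the Theorem's constants are uniform in the instance (A, k — hence η = L^{-k} —
and Ω), depending on d, M (and c₀ on α).  b04 typed the Theorem as `B4.ThmPrinted (fam : I → EtaSetting)`; pv17's
`ThmPrintedNN` is its `0 ≤ α` restriction
(referee ruling G-ref1-32), inhabited so far at `A = 0` (`B4Ineq111ZeroNestEta.thmPrintedNN_nestFam`), on the torus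
(`B4ThmZeroTorusEta`) and on nested BOXES at a regular field (p17 g5 `B4ThmBoxPairEta.thmPrintedNN_boxPairFam`,
`rect := True`).

WHAT THIS MODULE PROVES (all in full).
* §1 `isBlockUnion_of_dvd`, `region_pair_members` — the six members (r04's / r01's arbitrary-`f` theorems: (1.10) value,
  (1.10) derivative, (1.9) all pairs, δG value, δG derivative, δG Hölder all pairs) packaged with ONE block size `K` (the
  product of the members'; before `α`), ONE radius `K(d+4)` of the label-form `R₀` condition, and per `α` ONE constant
  and ONE rate `e^{−·/(4nK)}`.
* §2 `RegionPairInst`, `regionPairFam` — the family of settings: an instance is a scale `k ≥ 1` (`η = L^{-k}`), a pair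
  `Ω ⊆ Ω₀` of finite sets of unit labels (fine regions `fineDom`), `(a, m²)` in the windows, a component field `A_c` on
  the fine lattice and a coupling `e`; the setting's fields are the printed objects on `Ω`: distances in UNIT-lattice
  `ℓ^∞` units — `sdist1 x f = dist(x, supp f)`, **`cdist x = dist(x, Ω^c)`, the infimum over ALL fine lattice points
  outside `Ω`** (an infinite set; `⨅`), `bdistS f = dist(supp f, Ω^c)`; `‖f‖_∞ = supN`; `valG f x = |G_k(Ω,A)f(x)|`,
  `valDG μ f x = |D^η_{A,μ}G_k(Ω,A)f(x)|` (`G_k = (regionOp …)⁻¹` at the running coefficient `a_k`,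
  `D^η = regionDeriv`); `lhs19` = the supremum over the admissible contours `Γ_{x,x′}` (nearest-neighbour chains of `Ω`
  from `x` to `x′ ≠ x` with `|Γ| ≤ (d+1)|x′−x|_∞` inside the `|x′−x|_∞`-ball, both `μ`-bonds in `Ω`) of
  `|x−x′|^{-α}|U(A(Γ))(D_μGf)(x′) − (D_μGf)(x)|`; the `δ`-versions with `δ = G_k(Ω,A)f − (G_k(Ω₀,A)Ef)|Ω` (`E` =
  extension by zero); `regular` = (1.7) on `Ω₀` with the family's `(c, β)`; `bigBlocks` = `Ω`, `Ω₀` unions of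
  `K`-blocks; **`rect := False`** (the `R₀` restriction is imposed on every instance).
* §4 `claim18Printed_regionPairFam` — (1.8) on the same family (every `K`): `Claim18Printed (regionPairFam … K)` with
  `γ₀ = min(2, ¾a₋)/4`, by `B4Lower18RegularRegion.lower18_regular_region_printed` at the running coefficient.
* §3 **`thmPrintedNN_regionPairFam : ThmPrintedNN (regionPairFam F d ℓ a₋ a₊ m²₊ c β K)`** with `K = Kmod` — pv17's typed
  form of the printed Theorem `∀ α ∈ [0,1) ∃ δ₀ c₀ R₀ e₁ > 0 ∀ i, regular → bigBlocks → 0 < e ≤ e₁ → Ineq19_110 ∧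
  Ineq111_112` (`δ₀ = (4K)⁻¹`, `R₀ = K(d+4) + 2`), and `hypotheses_met` (non-vacuity for every threshold).
HONEST SCOPE.  As the members: abelian one-parameter orthogonal flow `U = F.U` (the print's (1.2)), component field
`A_ν(x)` with staircase contours on the cubes' boxes; `G_k(Ω,A)` at the running coefficient `a_k = B1.aSeq a L k`
(`a ∈ [a₋,a₊]`, `0 < a₋`) and mass `m² ∈ [0, m²₊]`; `L = ℓ+1 ≥ 2`; the block size `K` (= the print's `M` in unit blocks)
chosen after `d`, `N`, the flow's Lipschitz constant, `L` and the windows (print, p. 573: constants «depending on d, M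
only», `M` being fixed on p. 579 «if M is fixed such that 3^d c₂O(1)M^{−1} ≤ e^{−1}» — disclosed in `B4Thm110RegionLp`
(ii′)); distances in the `ℓ^∞` metric; in (1.12) the distances to `Ω₀ ∖ Ω` are replaced by the
(smaller) distances to `Ω^c`, as printed; `lhs19 = 0` when `Ω` contains no admissible contour between `x` and `x′`
(vacuous pairs; never the case on boxes); norms of vectors in `ℝ^N` Euclidean (`siteNorm`), `‖f‖_∞ = supN`;
`0 ≤ α < 1`; the waiver «without any restrictions … for rectangular parallelepipeds» is NOT claimed here (it is p17's box
family).  No `sorry`; no new `Prop` fact; axioms standard.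

REVISIONS (all DOCSTRING-ONLY, every declaration byte-identical with v1.0).  v1.1 (unit `lit-balaban-r01` gen 9,
2026-08-22): the WHAT IS PRINTED block above (verbatim Theorem sentence + standing hypotheses) and the `opX`/`opX₀`/
`regionPairFam` locators.  v1.2 (gen 21, 2026-08-22; labelled «v1.1» in its own text until this revision): locators of
Corollary 2.3 in the docstrings of `opX`, `opX₀`, `ssdist` «Cor. 2.3 (2.30) p.581» / «Corollary 2.3 p.581» →
«… (2.30) p.580» — Corollary 2.3 and its display (2.30) (the four inner products with the factor
`exp(−δ₀ dist(supp f, supp f′))`) are the end of p. 580 [PDF 10]; p. 581 carries only its δG sentence (class P69-008 of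
the summit-lit1 CITELOC register, found by an own-stem locator audit against the held text layer); citation-header
page list completed accordingly.  v1.3 (gen 39, 2026-08-23; quotation fidelity, re-read on the page renders p. 572 /
573 / 575 / 579 [PDF 2/3/5/9] and the held text layer): summit-lit1 Q-FID row QF84-003 — the tag of
`isBlockUnion_of_dvd` quoted «Ω … a sum of big blocks» under p. 572, which prints «We consider subsets Ω which are
unions of big blocks.» («a sum of big blocks» is p. 574's wording for `Λ` in (1.15), «a sum of large blocks» p. 575's) —
and, by the same own re-read, five further glosses that stood inside quotation marks are replaced by the printed words:
this header's title line and the docstring of `thmPrintedNN_regionPairFam` («Ω being a sum of big blocks»), the HONEST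
SCOPE clause on `M` (p. 573 «depending on d, M only», p. 579 «if M is fixed such that …»), the tag of `Adm` (p. 573 «let
us denote by Γ_{x,x′} a shortest contour connecting these points»), the tag of `Kmod` (p. 572 «cubes of size M called
big blocks»), and the (1.8) sentence in the docstring of `claim18Printed_regionPairFam` (p. 573 «The constant γ₀ is
independent of the lattice spacing η, as well as of Ω and of A.»).
-/

namespace Literature.MathematicalPhysics.QuantumFieldTheory.Balaban1983to89.B4ThmRegionPairEta

open Literature.MathematicalPhysics.QuantumFieldTheory.Balaban1983to89.B4 (EtaSetting Ineq19_110 Ineq111_112)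
open Literature.MathematicalPhysics.QuantumFieldTheory.Balaban1983to89.B4Ineq111ZeroNestEta (ThmPrintedNN)
open Literature.MathematicalPhysics.QuantumFieldTheory.Balaban1983to89.B4Reflection242 (blk nbrs blk_mul)
open Literature.MathematicalPhysics.QuantumFieldTheory.Balaban1983to89.B4GaugeCovariance
open Literature.MathematicalPhysics.QuantumFieldTheory.Balaban1983to89.B4ContourShift (supNorm supNorm_nonneg
  exists_supNorm_eq abs_le_supNorm)
open Literature.MathematicalPhysics.QuantumFieldTheory.Balaban1983to89.B4Lower18 (fineDom mem_fineDom IsBlockUnion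
  fineDom_isBlockUnion)
open Literature.MathematicalPhysics.QuantumFieldTheory.Balaban1983to89.B4Lower18Regular (e1 base_le_of_blk
  dotProduct_self_nonneg')
open Literature.MathematicalPhysics.QuantumFieldTheory.Balaban1983to89.B4Lemma21Region (regionOp regionDeriv siteNorm
  covDeriv fld_covDeriv_mulVec_of_not_mem fld_covDeriv_mulVec_of_mem)
open Literature.MathematicalPhysics.QuantumFieldTheory.Balaban1983to89.B4Lemma22Reduce231 (supN le_supN supN_nonneg
  siteNorm_nonneg siteNorm_zero siteNorm_smul)
open Literature.MathematicalPhysics.QuantumFieldTheory.Balaban1983to89.B4Lemma22HolderBox (IsNNChain)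
open Literature.MathematicalPhysics.QuantumFieldTheory.Balaban1983to89.B4Eq221L2FactorRegion (acBond)
open Literature.MathematicalPhysics.QuantumFieldTheory.Balaban1983to89.B4WalkRouteRegion (rpos)
open Literature.MathematicalPhysics.QuantumFieldTheory.Balaban1983to89.B4RegionCubeCarrier (incl inReg)
open Literature.MathematicalPhysics.QuantumFieldTheory.Balaban1983to89.B4Thm19RegionLpAll (isBlockUnion_of_mul)
open Literature.MathematicalPhysics.QuantumFieldTheory.Balaban1983to89.B4Thm110RegionAllF (thm110_value_region_allF
  thm110_deriv_region_allF thm112_value_region_allF)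
open Literature.MathematicalPhysics.QuantumFieldTheory.Balaban1983to89.B4Thm112RegionAllF (thm112_deriv_region_allF)
open Literature.MathematicalPhysics.QuantumFieldTheory.Balaban1983to89.B4Thm19RegionUnifK
  (thm19_holder_region_all_allF_unifK)
open Literature.MathematicalPhysics.QuantumFieldTheory.Balaban1983to89.B4Thm112RegionHolderUnifK
  (thm112_holder_region_all_allF_unifK)
open Literature.MathematicalPhysics.QuantumFieldTheory.Balaban1983to89.B4Thm112BoxValue (siteNorm_le_sqrt_card_mul
  abs_apply_le_siteNorm')
open scoped Matrix

noncomputable section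

variable {ι : Type} [Fintype ι] [DecidableEq ι]

/-! ## §1. The six members with one `K`, one radius, and per `α` one constant and one rate -/

omit [Fintype ι] [DecidableEq ι] in
/-- a finite union of `K`-blocks is a finite union of `K′`-blocks for `K′ ∣ K`. [cite: Balaban1983RegularityDecay, (1.1) p.572; p.572 «We consider subsets Ω which are unions of big blocks.»; dictionary] -/
theorem isBlockUnion_of_dvd {d : ℕ} {K K' : ℕ} {Ωc : Finset (Fin (d + 1) → ℤ)} (h : K' ∣ K)
    (hΩ : IsBlockUnion K Ωc) : IsBlockUnion K' Ωc := by
  obtain ⟨c, rfl⟩ := h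
  exact isBlockUnion_of_mul hΩ

/-- **THE SIX MEMBERS OF THE THEOREM ON A GENERAL PAIR `Ω ⊂ Ω₀`, FOR AN ARBITRARY `f`, PACKAGED**: (1.10) value and
derivative and (1.9) (all pairs) on `Ω`, and the three `δG` members, with ONE block size `K` (before `α`), ONE radius
`K(d+4)` of the label-form `R₀` condition, and for each `α ∈ [0,1)` ONE constant `C` and the rate `e^{−·/(4nK)}` (fine
units).  Sources on `Ω` resp. `Ω₀`, support predicate `P` at `ℓ^∞`-distance `≥ D` from the point(s); for `δG`:
`0 ≤ D₀ ≤` the distances of the point(s) to `Ω₀∖Ω`, `0 ≤ D₁ ≤ dist(P, Ω₀∖Ω)`.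
[cite: Balaban1983RegularityDecay, Theorem (1.9)–(1.12) p.573] -/
theorem region_pair_members (F : OrthFlow ι) {ℓ₁ : ℝ} (hℓ₁ : 0 ≤ ℓ₁)
    (hLip : ∀ t (v : ι → ℝ), ((F.U t - 1) *ᵥ v) ⬝ᵥ ((F.U t - 1) *ᵥ v) ≤ (ℓ₁ * t) ^ 2 * (v ⬝ᵥ v))
    (d ℓ : ℕ) (hℓ : 1 ≤ ℓ) (amin aplus m2plus : ℝ) (ha : 0 < amin) :
    ∃ K : ℕ, 16 ≤ K ∧ ∀ (α : ℝ), 0 ≤ α → α < 1 → ∃ C : ℝ, 0 < C ∧ ∀ (creg β : ℝ), 0 ≤ creg → 0 < β →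
      ∃ e₁ : ℝ, 0 < e₁ ∧ ∀ (k : ℕ), 1 ≤ k → ∀ (hn : 1 ≤ (ℓ + 1) ^ k) (a m2 : ℝ),
      amin ≤ a → a ≤ aplus → 0 ≤ m2 → m2 ≤ m2plus →
      ∀ (Ω₀c Ωc : Finset (Fin (d + 1) → ℤ)), IsBlockUnion K Ω₀c → IsBlockUnion K Ωc → ∀ (hsub : Ωc ⊆ Ω₀c)
      (Ac : (Fin (d + 1) → ℤ) → Fin (d + 1) → ℝ) (e : ℝ), 0 < e → e ≤ e₁ →
        (∀ x ∈ fineDom ((ℓ + 1) ^ k) Ω₀c, ∀ μ ν : Fin (d + 1),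
          |Ac (x + e1 μ) ν - Ac x ν| ≤ creg * e ^ (β - 1) / ((ℓ + 1) ^ k : ℕ)) →
      -- (1.10), value, on `Ω`
      (∀ (x : ↥(fineDom ((ℓ + 1) ^ k) Ωc)),
        (∀ y : Fin (d + 1) → ℤ, (∀ ν, |y ν - blk ((ℓ + 1) ^ k) x.1 ν| ≤ (K : ℤ) * (d + 4)) → y ∈ Ωc) →
        ∀ (P : ↥(fineDom ((ℓ + 1) ^ k) Ωc) → Prop) (D : ℝ), 0 ≤ D →
        (∀ x', P x' → ∃ ν, D ≤ |rpos ((ℓ + 1) ^ k) Ωc x ν - rpos ((ℓ + 1) ^ k) Ωc x' ν|) →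
        ∀ (f : ↥(fineDom ((ℓ + 1) ^ k) Ωc) × ι → ℝ), (∀ p, ¬ P p.1 → f p = 0) → ∀ i : ι,
        |((regionOp F e hn (B1.aSeq a ((ℓ : ℝ) + 1) k) m2 Ωc Ac)⁻¹ *ᵥ f) (x, i)|
          ≤ C * Real.exp (-(D / (4 * ((((ℓ + 1) ^ k : ℕ) : ℝ) * K)))) * ‖f‖) ∧
      -- (1.10), derivative, on `Ω`
      (∀ (μ : Fin (d + 1)) (x : ↥(fineDom ((ℓ + 1) ^ k) Ωc)), x.1 + e1 μ ∈ fineDom ((ℓ + 1) ^ k) Ωc →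
        (∀ y : Fin (d + 1) → ℤ, (∀ ν, |y ν - blk ((ℓ + 1) ^ k) x.1 ν| ≤ (K : ℤ) * (d + 4)) → y ∈ Ωc) →
        ∀ (P : ↥(fineDom ((ℓ + 1) ^ k) Ωc) → Prop) (D : ℝ), 0 ≤ D →
        (∀ x', P x' → ∃ ν, D ≤ |rpos ((ℓ + 1) ^ k) Ωc x ν - rpos ((ℓ + 1) ^ k) Ωc x' ν|) →
        ∀ (f : ↥(fineDom ((ℓ + 1) ^ k) Ωc) × ι → ℝ), (∀ p, ¬ P p.1 → f p = 0) → ∀ i : ι,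
        |(regionDeriv F e ((ℓ + 1) ^ k) Ωc Ac μ
            *ᵥ ((regionOp F e hn (B1.aSeq a ((ℓ : ℝ) + 1) k) m2 Ωc Ac)⁻¹ *ᵥ f)) (x, i)|
          ≤ C * Real.exp (-(D / (4 * ((((ℓ + 1) ^ k : ℕ) : ℝ) * K)))) * ‖f‖) ∧
      -- (1.9) on `Ω`, all pairs
      (∀ (μ : Fin (d + 1)) (x x' : ↥(fineDom ((ℓ + 1) ^ k) Ωc)), x.1 + e1 μ ∈ fineDom ((ℓ + 1) ^ k) Ωc →
        x'.1 + e1 μ ∈ fineDom ((ℓ + 1) ^ k) Ωc → x'.1 ≠ x.1 →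
        ∀ (l : List ↥(fineDom ((ℓ + 1) ^ k) Ωc)), IsNNChain x l → pathEnd x l = x' →
        (l.length : ℝ) ≤ ((d : ℝ) + 1) * supNorm (x'.1 - x.1) →
        (∀ z ∈ l, supNorm (z.1 - x.1) ≤ supNorm (x'.1 - x.1)) →
        (∀ y : Fin (d + 1) → ℤ, (∀ ν, |y ν - blk ((ℓ + 1) ^ k) x.1 ν| ≤ (K : ℤ) * (d + 4)) → y ∈ Ωc) →
        (∀ y : Fin (d + 1) → ℤ, (∀ ν, |y ν - blk ((ℓ + 1) ^ k) x'.1 ν| ≤ (K : ℤ) * (d + 4)) → y ∈ Ωc) →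
        ∀ (P : ↥(fineDom ((ℓ + 1) ^ k) Ωc) → Prop) (D : ℝ), 0 ≤ D →
        (∀ x'', P x'' → ∃ ν, D ≤ |rpos ((ℓ + 1) ^ k) Ωc x ν - rpos ((ℓ + 1) ^ k) Ωc x'' ν|) →
        (∀ x'', P x'' → ∃ ν, D ≤ |rpos ((ℓ + 1) ^ k) Ωc x' ν - rpos ((ℓ + 1) ^ k) Ωc x'' ν|) →
        ∀ (f : ↥(fineDom ((ℓ + 1) ^ k) Ωc) × ι → ℝ), (∀ p, ¬ P p.1 → f p = 0) → ∀ i : ι,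
        ((((ℓ + 1) ^ k : ℕ) : ℝ) / supNorm (x'.1 - x.1)) ^ α *
          |(transport (fieldLink F (e / ((ℓ + 1) ^ k : ℕ)) (acBond Ωc Ac)) x l
              *ᵥ fld (regionDeriv F e ((ℓ + 1) ^ k) Ωc Ac μ
                    *ᵥ ((regionOp F e hn (B1.aSeq a ((ℓ : ℝ) + 1) k) m2 Ωc Ac)⁻¹ *ᵥ f)) x'
            - fld (regionDeriv F e ((ℓ + 1) ^ k) Ωc Ac μ
                    *ᵥ ((regionOp F e hn (B1.aSeq a ((ℓ : ℝ) + 1) k) m2 Ωc Ac)⁻¹ *ᵥ f)) x) i|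
          ≤ C * Real.exp (-(D / (4 * ((((ℓ + 1) ^ k : ℕ) : ℝ) * K)))) * ‖f‖) ∧
      -- `δG`, value
      (∀ (x : ↥(fineDom ((ℓ + 1) ^ k) Ωc)),
        (∀ y : Fin (d + 1) → ℤ, (∀ ν, |y ν - blk ((ℓ + 1) ^ k) x.1 ν| ≤ (K : ℤ) * (d + 4)) → y ∈ Ωc) →
        ∀ (P : ↥(fineDom ((ℓ + 1) ^ k) Ω₀c) → Prop) (D D₀ D₁ : ℝ), 0 ≤ D → 0 ≤ D₀ → 0 ≤ D₁ →
        (∀ x', P x' → ∃ ν, D ≤ |rpos ((ℓ + 1) ^ k) Ω₀c (incl hn hsub x) ν - rpos ((ℓ + 1) ^ k) Ω₀c x' ν|) →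
        (∀ x₁ : ↥(fineDom ((ℓ + 1) ^ k) Ω₀c), ¬ inReg ((ℓ + 1) ^ k) Ωc x₁ →
          ∃ ν, D₀ ≤ |rpos ((ℓ + 1) ^ k) Ω₀c (incl hn hsub x) ν - rpos ((ℓ + 1) ^ k) Ω₀c x₁ ν|) →
        (∀ x', P x' → ∀ x₁ : ↥(fineDom ((ℓ + 1) ^ k) Ω₀c), ¬ inReg ((ℓ + 1) ^ k) Ωc x₁ →
          ∃ ν, D₁ ≤ |rpos ((ℓ + 1) ^ k) Ω₀c x₁ ν - rpos ((ℓ + 1) ^ k) Ω₀c x' ν|) →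
        ∀ (f : ↥(fineDom ((ℓ + 1) ^ k) Ω₀c) × ι → ℝ), (∀ p, ¬ P p.1 → f p = 0) → ∀ i : ι,
        |((regionOp F e hn (B1.aSeq a ((ℓ : ℝ) + 1) k) m2 Ωc Ac)⁻¹
              *ᵥ (fun q : ↥(fineDom ((ℓ + 1) ^ k) Ωc) × ι => f (incl hn hsub q.1, q.2))) (x, i)
          - ((regionOp F e hn (B1.aSeq a ((ℓ : ℝ) + 1) k) m2 Ω₀c Ac)⁻¹ *ᵥ f) (incl hn hsub x, i)|
          ≤ C * Real.exp (-((D₀ + D₁) / (4 * ((((ℓ + 1) ^ k : ℕ) : ℝ) * K))))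
            * Real.exp (-(D / (4 * ((((ℓ + 1) ^ k : ℕ) : ℝ) * K)))) * ‖f‖) ∧
      -- `δG`, derivative
      (∀ (μ : Fin (d + 1)) (x : ↥(fineDom ((ℓ + 1) ^ k) Ωc)), x.1 + e1 μ ∈ fineDom ((ℓ + 1) ^ k) Ωc →
        (∀ y : Fin (d + 1) → ℤ, (∀ ν, |y ν - blk ((ℓ + 1) ^ k) x.1 ν| ≤ (K : ℤ) * (d + 4)) → y ∈ Ωc) →
        ∀ (P : ↥(fineDom ((ℓ + 1) ^ k) Ω₀c) → Prop) (D D₀ D₁ : ℝ), 0 ≤ D → 0 ≤ D₀ → 0 ≤ D₁ →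
        (∀ x', P x' → ∃ ν, D ≤ |rpos ((ℓ + 1) ^ k) Ω₀c (incl hn hsub x) ν - rpos ((ℓ + 1) ^ k) Ω₀c x' ν|) →
        (∀ x₁ : ↥(fineDom ((ℓ + 1) ^ k) Ω₀c), ¬ inReg ((ℓ + 1) ^ k) Ωc x₁ →
          ∃ ν, D₀ ≤ |rpos ((ℓ + 1) ^ k) Ω₀c (incl hn hsub x) ν - rpos ((ℓ + 1) ^ k) Ω₀c x₁ ν|) →
        (∀ x', P x' → ∀ x₁ : ↥(fineDom ((ℓ + 1) ^ k) Ω₀c), ¬ inReg ((ℓ + 1) ^ k) Ωc x₁ →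
          ∃ ν, D₁ ≤ |rpos ((ℓ + 1) ^ k) Ω₀c x₁ ν - rpos ((ℓ + 1) ^ k) Ω₀c x' ν|) →
        ∀ (f : ↥(fineDom ((ℓ + 1) ^ k) Ω₀c) × ι → ℝ), (∀ p, ¬ P p.1 → f p = 0) → ∀ i : ι,
        |(regionDeriv F e ((ℓ + 1) ^ k) Ωc Ac μ
              *ᵥ ((regionOp F e hn (B1.aSeq a ((ℓ : ℝ) + 1) k) m2 Ωc Ac)⁻¹
                *ᵥ (fun q : ↥(fineDom ((ℓ + 1) ^ k) Ωc) × ι => f (incl hn hsub q.1, q.2)))) (x, i)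
          - (regionDeriv F e ((ℓ + 1) ^ k) Ω₀c Ac μ
              *ᵥ ((regionOp F e hn (B1.aSeq a ((ℓ : ℝ) + 1) k) m2 Ω₀c Ac)⁻¹ *ᵥ f)) (incl hn hsub x, i)|
          ≤ C * Real.exp (-((D₀ + D₁) / (4 * ((((ℓ + 1) ^ k : ℕ) : ℝ) * K))))
            * Real.exp (-(D / (4 * ((((ℓ + 1) ^ k : ℕ) : ℝ) * K)))) * ‖f‖) ∧
      -- `δG`, Hölder, all pairs
      (∀ (μ : Fin (d + 1)) (x x' : ↥(fineDom ((ℓ + 1) ^ k) Ωc)), x.1 + e1 μ ∈ fineDom ((ℓ + 1) ^ k) Ωc →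
        x'.1 + e1 μ ∈ fineDom ((ℓ + 1) ^ k) Ωc → x'.1 ≠ x.1 →
        ∀ (l : List ↥(fineDom ((ℓ + 1) ^ k) Ωc)), IsNNChain x l → pathEnd x l = x' →
        (l.length : ℝ) ≤ ((d : ℝ) + 1) * supNorm (x'.1 - x.1) →
        (∀ z ∈ l, supNorm (z.1 - x.1) ≤ supNorm (x'.1 - x.1)) →
        (∀ y : Fin (d + 1) → ℤ, (∀ ν, |y ν - blk ((ℓ + 1) ^ k) x.1 ν| ≤ (K : ℤ) * (d + 4)) → y ∈ Ωc) →
        (∀ y : Fin (d + 1) → ℤ, (∀ ν, |y ν - blk ((ℓ + 1) ^ k) x'.1 ν| ≤ (K : ℤ) * (d + 4)) → y ∈ Ωc) →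
        ∀ (P : ↥(fineDom ((ℓ + 1) ^ k) Ω₀c) → Prop) (D D₀ D₁ : ℝ), 0 ≤ D → 0 ≤ D₀ → 0 ≤ D₁ →
        (∀ x'', P x'' → ∃ ν, D ≤ |rpos ((ℓ + 1) ^ k) Ω₀c (incl hn hsub x) ν - rpos ((ℓ + 1) ^ k) Ω₀c x'' ν|) →
        (∀ x'', P x'' → ∃ ν, D ≤ |rpos ((ℓ + 1) ^ k) Ω₀c (incl hn hsub x') ν - rpos ((ℓ + 1) ^ k) Ω₀c x'' ν|) →
        (∀ x₁ : ↥(fineDom ((ℓ + 1) ^ k) Ω₀c), ¬ inReg ((ℓ + 1) ^ k) Ωc x₁ →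
          ∃ ν, D₀ ≤ |rpos ((ℓ + 1) ^ k) Ω₀c (incl hn hsub x) ν - rpos ((ℓ + 1) ^ k) Ω₀c x₁ ν|) →
        (∀ x₁ : ↥(fineDom ((ℓ + 1) ^ k) Ω₀c), ¬ inReg ((ℓ + 1) ^ k) Ωc x₁ →
          ∃ ν, D₀ ≤ |rpos ((ℓ + 1) ^ k) Ω₀c (incl hn hsub x') ν - rpos ((ℓ + 1) ^ k) Ω₀c x₁ ν|) →
        (∀ x'', P x'' → ∀ x₁ : ↥(fineDom ((ℓ + 1) ^ k) Ω₀c), ¬ inReg ((ℓ + 1) ^ k) Ωc x₁ →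
          ∃ ν, D₁ ≤ |rpos ((ℓ + 1) ^ k) Ω₀c x₁ ν - rpos ((ℓ + 1) ^ k) Ω₀c x'' ν|) →
        ∀ (f : ↥(fineDom ((ℓ + 1) ^ k) Ω₀c) × ι → ℝ), (∀ p, ¬ P p.1 → f p = 0) → ∀ i : ι,
        ((((ℓ + 1) ^ k : ℕ) : ℝ) / supNorm (x'.1 - x.1)) ^ α *
          |(transport (fieldLink F (e / ((ℓ + 1) ^ k : ℕ)) (acBond Ωc Ac)) x l
              *ᵥ fld (regionDeriv F e ((ℓ + 1) ^ k) Ωc Ac μ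
                    *ᵥ ((regionOp F e hn (B1.aSeq a ((ℓ : ℝ) + 1) k) m2 Ωc Ac)⁻¹
                      *ᵥ (fun q : ↥(fineDom ((ℓ + 1) ^ k) Ωc) × ι => f (incl hn hsub q.1, q.2)))) x'
            - fld (regionDeriv F e ((ℓ + 1) ^ k) Ωc Ac μ
                    *ᵥ ((regionOp F e hn (B1.aSeq a ((ℓ : ℝ) + 1) k) m2 Ωc Ac)⁻¹
                      *ᵥ (fun q : ↥(fineDom ((ℓ + 1) ^ k) Ωc) × ι => f (incl hn hsub q.1, q.2)))) x
            - (transport (fieldLink F (e / ((ℓ + 1) ^ k : ℕ)) (acBond Ωc Ac)) x l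
                *ᵥ fld (regionDeriv F e ((ℓ + 1) ^ k) Ω₀c Ac μ
                      *ᵥ ((regionOp F e hn (B1.aSeq a ((ℓ : ℝ) + 1) k) m2 Ω₀c Ac)⁻¹ *ᵥ f)) (incl hn hsub x')
              - fld (regionDeriv F e ((ℓ + 1) ^ k) Ω₀c Ac μ
                      *ᵥ ((regionOp F e hn (B1.aSeq a ((ℓ : ℝ) + 1) k) m2 Ω₀c Ac)⁻¹ *ᵥ f)) (incl hn hsub x))) i|
          ≤ C * Real.exp (-((D₀ + D₁) / (4 * ((((ℓ + 1) ^ k : ℕ) : ℝ) * K))))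
            * Real.exp (-(D / (4 * ((((ℓ + 1) ^ k : ℕ) : ℝ) * K)))) * ‖f‖) := by
  obtain ⟨K₁, hK₁, h8₁, c₁, hc₁, H₁⟩ := thm110_value_region_allF F hℓ₁ hLip d ℓ hℓ amin aplus m2plus ha
  obtain ⟨K₂, hK₂, h8₂, c₂, hc₂, H₂⟩ := thm110_deriv_region_allF F hℓ₁ hLip d ℓ hℓ amin aplus m2plus ha
  obtain ⟨K₃, hK₃, h8₃, HU₃⟩ := thm19_holder_region_all_allF_unifK F hℓ₁ hLip d ℓ hℓ amin aplus m2plus ha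
  obtain ⟨K₄, hK₄, h8₄, c₄, hc₄, H₄⟩ := thm112_value_region_allF F hℓ₁ hLip d ℓ hℓ amin aplus m2plus ha
  obtain ⟨K₅, hK₅, h8₅, c₅, hc₅, H₅⟩ := thm112_deriv_region_allF F hℓ₁ hLip d ℓ hℓ amin aplus m2plus ha
  obtain ⟨K₆, hK₆, h8₆, HU₆⟩ := thm112_holder_region_all_allF_unifK F hℓ₁ hLip d ℓ hℓ amin aplus m2plus ha
  have hK₁1 : 1 ≤ K₁ := le_trans (by norm_num) hK₁
  have hK₂1 : 1 ≤ K₂ := le_trans (by norm_num) hK₂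
  have hK₃1 : 1 ≤ K₃ := le_trans (by norm_num) hK₃
  have hK₄1 : 1 ≤ K₄ := le_trans (by norm_num) hK₄
  have hK₅1 : 1 ≤ K₅ := le_trans (by norm_num) hK₅
  have hK₆1 : 1 ≤ K₆ := le_trans (by norm_num) hK₆
  set K : ℕ := K₁ * (K₂ * (K₃ * (K₄ * (K₅ * K₆)))) with hK
  have hd₁ : K₁ ∣ K := Dvd.intro _ rfl
  have hd₂ : K₂ ∣ K := by rw [hK]; exact Dvd.dvd.mul_left (Dvd.intro _ rfl) _
  have hd₃ : K₃ ∣ K := by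
    rw [hK]; exact Dvd.dvd.mul_left (Dvd.dvd.mul_left (Dvd.intro _ rfl) _) _
  have hd₄ : K₄ ∣ K := by
    rw [hK]; exact Dvd.dvd.mul_left (Dvd.dvd.mul_left (Dvd.dvd.mul_left (Dvd.intro _ rfl) _) _) _
  have hd₅ : K₅ ∣ K := by
    rw [hK]
    exact Dvd.dvd.mul_left (Dvd.dvd.mul_left (Dvd.dvd.mul_left (Dvd.dvd.mul_left (Dvd.intro _ rfl) _) _) _) _
  have hd₆ : K₆ ∣ K := by
    rw [hK]
    exact Dvd.dvd.mul_left (Dvd.dvd.mul_left (Dvd.dvd.mul_left (Dvd.dvd.mul_left (Dvd.intro_left _ rfl) _) _) _) _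
  have hKpos : 0 < K := by positivity
  have hle : ∀ K' : ℕ, K' ∣ K → K' ≤ K := fun K' h => Nat.le_of_dvd hKpos h
  have hK16 : 16 ≤ K := hK₃.trans (hle _ hd₃)
  have hKr : (0 : ℝ) < K := by exact_mod_cast hKpos
  -- the `R₀` radius `K(d+4)` dominates every member's radius
  have hrad : ∀ (K' : ℕ), K' ∣ K → ∀ {n : ℕ} (Ωc : Finset (Fin (d + 1) → ℤ)) (z : Fin (d + 1) → ℤ),
      (∀ y : Fin (d + 1) → ℤ, (∀ ν, |y ν - blk n z ν| ≤ (K : ℤ) * (d + 4)) → y ∈ Ωc) →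
      (∀ y : Fin (d + 1) → ℤ, (∀ ν, |y ν - blk n z ν| ≤ (K' : ℤ) * (d + 4)) → y ∈ Ωc) ∧
      (∀ y : Fin (d + 1) → ℤ, (∀ ν, |y ν - blk n z ν| ≤ (K' : ℤ) * (d + 3)) → y ∈ Ωc) ∧
      (∀ y : Fin (d + 1) → ℤ, (∀ ν, |y ν - blk n z ν| ≤ (K' : ℤ) * (d + 3) + 1) → y ∈ Ωc) := by
    intro K' hK' n Ωc z hz
    have h1 : (K' : ℤ) ≤ K := by exact_mod_cast hle K' hK'
    have h2 : (1 : ℤ) ≤ K' := by exact_mod_cast Nat.pos_of_dvd_of_pos hK' hKpos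
    have hd0 : (0 : ℤ) ≤ d := Int.natCast_nonneg d
    refine ⟨fun y hy => hz y fun ν => (hy ν).trans (by nlinarith),
      fun y hy => hz y fun ν => (hy ν).trans (by nlinarith), fun y hy => hz y fun ν => (hy ν).trans (by nlinarith)⟩
  -- rates
  have hrate : ∀ (K' : ℕ), 1 ≤ K' → K' ∣ K → ∀ {n : ℕ}, 1 ≤ n → ∀ {S : ℝ}, 0 ≤ S → ∀ (j : ℝ), 1 ≤ j → j ≤ 4 →
      Real.exp (-(S / (j * ((n : ℝ) * K')))) ≤ Real.exp (-(S / (4 * ((n : ℝ) * K)))) := by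
    intro K' hK'1 hK'K n hn S hS j hj1 hj4
    have hK'r : (0 : ℝ) < K' := by exact_mod_cast hK'1
    have hnr : (0 : ℝ) < n := by exact_mod_cast hn
    have hKK : (K' : ℝ) ≤ K := by exact_mod_cast hle K' hK'K
    refine Real.exp_le_exp.mpr (neg_le_neg (div_le_div_of_nonneg_left hS (by positivity) ?_))
    calc j * ((n : ℝ) * K') ≤ 4 * ((n : ℝ) * K') := by gcongr
      _ ≤ 4 * ((n : ℝ) * K) := by gcongr
  refine ⟨K, hK16, fun α hα0 hα1 => ?_⟩
  obtain ⟨c₃, hc₃, H₃⟩ := HU₃ α hα0 hα1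
  obtain ⟨c₆, hc₆, H₆⟩ := HU₆ α hα0 hα1
  set C : ℝ := c₁ + c₂ + c₃ + c₄ + c₅ + c₆ with hC
  have hC0 : 0 < C := by positivity
  have hc₁C : c₁ ≤ C := by rw [hC]; linarith only [hc₂, hc₃, hc₄, hc₅, hc₆]
  have hc₂C : c₂ ≤ C := by rw [hC]; linarith only [hc₁, hc₃, hc₄, hc₅, hc₆]
  have hc₃C : c₃ ≤ C := by rw [hC]; linarith only [hc₁, hc₂, hc₄, hc₅, hc₆]
  have hc₄C : c₄ ≤ C := by rw [hC]; linarith only [hc₁, hc₂, hc₃, hc₅, hc₆]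
  have hc₅C : c₅ ≤ C := by rw [hC]; linarith only [hc₁, hc₂, hc₃, hc₄, hc₆]
  have hc₆C : c₆ ≤ C := by rw [hC]; linarith only [hc₁, hc₂, hc₃, hc₄, hc₅]
  refine ⟨C, hC0, fun creg β hcreg hβ => ?_⟩
  obtain ⟨e₁, he₁, H₁'⟩ := H₁ creg β hcreg hβ
  obtain ⟨e₂, he₂, H₂'⟩ := H₂ creg β hcreg hβ
  obtain ⟨e₃, he₃, H₃'⟩ := H₃ creg β hcreg hβ
  obtain ⟨e₄, he₄, H₄'⟩ := H₄ creg β hcreg hβ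
  obtain ⟨e₅, he₅, H₅'⟩ := H₅ creg β hcreg hβ
  obtain ⟨e₆, he₆, H₆'⟩ := H₆ creg β hcreg hβ
  set eM : ℝ := min (min e₁ (min e₂ e₃)) (min e₄ (min e₅ e₆)) with heM
  refine ⟨eM, by positivity, ?_⟩
  intro k hk hn a m2 ha1 ha2 hm1 hm2 Ω₀c Ωc hΩ₀ hΩ hsub Ac e he hle' h17
  have hl₁ : e ≤ e₁ := hle'.trans ((min_le_left _ _).trans (min_le_left _ _))
  have hl₂ : e ≤ e₂ := hle'.trans ((min_le_left _ _).trans ((min_le_right _ _).trans (min_le_left _ _)))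
  have hl₃ : e ≤ e₃ := hle'.trans ((min_le_left _ _).trans ((min_le_right _ _).trans (min_le_right _ _)))
  have hl₄ : e ≤ e₄ := hle'.trans ((min_le_right _ _).trans (min_le_left _ _))
  have hl₅ : e ≤ e₅ := hle'.trans ((min_le_right _ _).trans ((min_le_right _ _).trans (min_le_left _ _)))
  have hl₆ : e ≤ e₆ := hle'.trans ((min_le_right _ _).trans ((min_le_right _ _).trans (min_le_right _ _)))
  -- (1.7) on `Ω` from (1.7) on `Ω₀`
  have h17Ω : ∀ x ∈ fineDom ((ℓ + 1) ^ k) Ωc, ∀ μ ν : Fin (d + 1),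
      |Ac (x + e1 μ) ν - Ac x ν| ≤ creg * e ^ (β - 1) / ((ℓ + 1) ^ k : ℕ) :=
    fun x hx μ ν => h17 x (B4RegionCubeCarrier.fineDom_mono hn hsub hx) μ ν
  refine ⟨?_, ?_, ?_, ?_, ?_, ?_⟩
  · intro x hxR P D hD0 hD f hfP i
    have h := H₁' k hk hn a m2 ha1 ha2 hm1 hm2 Ωc (isBlockUnion_of_dvd hd₁ hΩ) Ac e he hl₁ h17Ω x
      (hrad K₁ hd₁ Ωc x.1 hxR).2.1 P D hD f hfP i
    exact h.trans (mul_le_mul_of_nonneg_right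
      (mul_le_mul hc₁C (hrate K₁ hK₁1 hd₁ hn hD0 2 (by norm_num) (by norm_num)) (Real.exp_pos _).le hC0.le)
      (norm_nonneg _))
  · intro μ x hxμ hxR P D hD0 hD f hfP i
    have h := H₂' k hk hn a m2 ha1 ha2 hm1 hm2 Ωc (isBlockUnion_of_dvd hd₂ hΩ) Ac e he hl₂ h17Ω μ x hxμ
      (hrad K₂ hd₂ Ωc x.1 hxR).2.2 P D hD f hfP i
    exact h.trans (mul_le_mul_of_nonneg_right
      (mul_le_mul hc₂C (hrate K₂ hK₂1 hd₂ hn hD0 2 (by norm_num) (by norm_num)) (Real.exp_pos _).le hC0.le)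
      (norm_nonneg _))
  · intro μ x x' hxμ hx'μ hne l hl hlend hlen hlnear hxR hx'R P D hD0 hD hD' f hfP i
    have h := H₃' k hk hn a m2 ha1 ha2 hm1 hm2 Ωc (isBlockUnion_of_dvd hd₃ hΩ) Ac e he hl₃ h17Ω μ x x' hxμ hx'μ hne
      l hl hlend hlen hlnear (hrad K₃ hd₃ Ωc x.1 hxR).1 (hrad K₃ hd₃ Ωc x'.1 hx'R).1 P D hD hD' f hfP i
    exact h.trans (mul_le_mul_of_nonneg_right
      (mul_le_mul hc₃C (hrate K₃ hK₃1 hd₃ hn hD0 2 (by norm_num) (by norm_num)) (Real.exp_pos _).le hC0.le)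
      (norm_nonneg _))
  · intro x hxR P D D₀ D₁ hD0 hD₀0 hD₁0 hD hD₀ hD₁ f hfP i
    have h := H₄' k hk hn a m2 ha1 ha2 hm1 hm2 Ω₀c Ωc (isBlockUnion_of_dvd hd₄ hΩ₀) (isBlockUnion_of_dvd hd₄ hΩ)
      hsub Ac e he hl₄ h17 x (hrad K₄ hd₄ Ωc x.1 hxR).2.1 P D D₀ D₁ hD hD₀ hD₁ f hfP i
    refine h.trans (mul_le_mul_of_nonneg_right ?_ (norm_nonneg _))
    exact mul_le_mul (mul_le_mul hc₄C (hrate K₄ hK₄1 hd₄ hn (by positivity) 2 (by norm_num) (by norm_num))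
      (Real.exp_pos _).le hC0.le) (hrate K₄ hK₄1 hd₄ hn hD0 4 (by norm_num) le_rfl) (Real.exp_pos _).le
      (by positivity)
  · intro μ x hxμ hxR P D D₀ D₁ hD0 hD₀0 hD₁0 hD hD₀ hD₁ f hfP i
    have h := H₅' k hk hn a m2 ha1 ha2 hm1 hm2 Ω₀c Ωc (isBlockUnion_of_dvd hd₅ hΩ₀) (isBlockUnion_of_dvd hd₅ hΩ)
      hsub Ac e he hl₅ h17 μ x hxμ (hrad K₅ hd₅ Ωc x.1 hxR).2.2 P D D₀ D₁ hD hD₀ hD₁ f hfP i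
    refine h.trans (mul_le_mul_of_nonneg_right ?_ (norm_nonneg _))
    exact mul_le_mul (mul_le_mul hc₅C (hrate K₅ hK₅1 hd₅ hn (by positivity) 2 (by norm_num) (by norm_num))
      (Real.exp_pos _).le hC0.le) (hrate K₅ hK₅1 hd₅ hn hD0 4 (by norm_num) le_rfl) (Real.exp_pos _).le
      (by positivity)
  · intro μ x x' hxμ hx'μ hne l hl hlend hlen hlnear hxR hx'R P D D₀ D₁ hD0 hD₀0 hD₁0 hD hD' hD₀ hD₀' hD₁ f hfP i
    have h := H₆' k hk hn a m2 ha1 ha2 hm1 hm2 Ω₀c Ωc (isBlockUnion_of_dvd hd₆ hΩ₀) (isBlockUnion_of_dvd hd₆ hΩ)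
      hsub Ac e he hl₆ h17 μ x x' hxμ hx'μ hne l hl hlend hlen hlnear (hrad K₆ hd₆ Ωc x.1 hxR).1
      (hrad K₆ hd₆ Ωc x'.1 hx'R).1 P D D₀ D₁ hD₀0 hD₁0 hD hD' hD₀ hD₀' hD₁ f hfP i
    refine h.trans (mul_le_mul_of_nonneg_right ?_ (norm_nonneg _))
    exact mul_le_mul (mul_le_mul hc₆C (hrate K₆ hK₆1 hd₆ hn (by positivity) 2 (by norm_num) (by norm_num))
      (Real.exp_pos _).le hC0.le) (hrate K₆ hK₆1 hd₆ hn hD0 4 (by norm_num) le_rfl) (Real.exp_pos _).le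
      (by positivity)

/-! ## §2. The instances and the family of settings -/

/-- AN INSTANCE: a scale `k ≥ 1` (`η = (ℓ+1)^{-k}`), a pair `Ω ⊆ Ω₀` of finite sets of unit labels (the fine regions
`fineDom n Ω ⊆ fineDom n Ω₀` are the print's `Ω ⊂ Ω₀`), `(a, m²)` in the windows `[a₋,a₊] × [0,m²₊]`, a component field
`A_c` on the fine lattice and a coupling `e`. [cite: Balaban1983RegularityDecay, Theorem p.573, (1.1)–(1.6) p.572] -/
structure RegionPairInst (d ℓ : ℕ) (amin aplus m2plus : ℝ) where
  /-- the scale -/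
  k : ℕ
  hk : 1 ≤ k
  /-- the unit labels of `Ω₀` -/
  Ω₀c : Finset (Fin (d + 1) → ℤ)
  /-- the unit labels of `Ω` -/
  Ωc : Finset (Fin (d + 1) → ℤ)
  hsub : Ωc ⊆ Ω₀c
  /-- the averaging weight `a` and the mass `m²` -/
  a : ℝ
  m2 : ℝ
  ha1 : amin ≤ a
  ha2 : a ≤ aplus
  hm1 : 0 ≤ m2
  hm2 : m2 ≤ m2plus
  /-- the component field `A_c` of (1.2) on the fine lattice -/
  Ac : (Fin (d + 1) → ℤ) → Fin (d + 1) → ℝ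
  /-- the coupling -/
  e : ℝ

namespace RegionPairInst

variable {d ℓ : ℕ} {amin aplus m2plus : ℝ} (i : RegionPairInst d ℓ amin aplus m2plus)

/-- the coupling at scale `η`: `eη = e/n`. [cite: Balaban1983RegularityDecay, (1.2) p.572, dictionary] -/
abbrev κ : ℝ := i.e / ((ℓ + 1) ^ i.k : ℕ)

variable (F : OrthFlow ι)

/-- `G_k(Ω, A)` (1.6), at the running coefficient `a_k`. [cite: Balaban1983RegularityDecay, (1.6) p.572] -/
abbrev GΩ : Matrix (↥(fineDom ((ℓ + 1) ^ i.k) i.Ωc) × ι) (↥(fineDom ((ℓ + 1) ^ i.k) i.Ωc) × ι) ℝ :=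
  (regionOp F i.e (Nat.one_le_pow i.k (ℓ + 1) (Nat.succ_pos ℓ)) (B1.aSeq i.a ((ℓ : ℝ) + 1) i.k) i.m2 i.Ωc i.Ac)⁻¹

/-- `G_k(Ω₀, A)` (1.6). [cite: Balaban1983RegularityDecay, (1.6) p.572] -/
abbrev G₀ : Matrix (↥(fineDom ((ℓ + 1) ^ i.k) i.Ω₀c) × ι) (↥(fineDom ((ℓ + 1) ^ i.k) i.Ω₀c) × ι) ℝ :=
  (regionOp F i.e (Nat.one_le_pow i.k (ℓ + 1) (Nat.succ_pos ℓ)) (B1.aSeq i.a ((ℓ : ℝ) + 1) i.k) i.m2 i.Ω₀c i.Ac)⁻¹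

/-- `D^η_{A,μ}` on `Ω` (1.3). [cite: Balaban1983RegularityDecay, (1.3) p.572] -/
abbrev DΩ (μ : Fin (d + 1)) : Matrix (↥(fineDom ((ℓ + 1) ^ i.k) i.Ωc) × ι) (↥(fineDom ((ℓ + 1) ^ i.k) i.Ωc) × ι) ℝ :=
  regionDeriv F i.e ((ℓ + 1) ^ i.k) i.Ωc i.Ac μ

/-- `D^η_{A,μ}` on `Ω₀` (1.3). [cite: Balaban1983RegularityDecay, (1.3) p.572] -/
abbrev D₀ (μ : Fin (d + 1)) : Matrix (↥(fineDom ((ℓ + 1) ^ i.k) i.Ω₀c) × ι) (↥(fineDom ((ℓ + 1) ^ i.k) i.Ω₀c) × ι) ℝ :=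
  regionDeriv F i.e ((ℓ + 1) ^ i.k) i.Ω₀c i.Ac μ

/-- extension by zero `E : (Ω → ℝ^N) → (Ω₀ → ℝ^N)`. [cite: Balaban1983RegularityDecay, (1.11) p.573, dictionary] -/
def extR (f : ↥(fineDom ((ℓ + 1) ^ i.k) i.Ωc) × ι → ℝ) : ↥(fineDom ((ℓ + 1) ^ i.k) i.Ω₀c) × ι → ℝ :=
  fun p => if h : inReg ((ℓ + 1) ^ i.k) i.Ωc p.1 then f (⟨p.1.1, (mem_fineDom (Nat.one_le_pow i.k (ℓ + 1) (Nat.succ_pos ℓ))).2 h⟩, p.2) else 0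

/-- restriction `(Ω₀ → ℝ^N) → (Ω → ℝ^N)`. [cite: Balaban1983RegularityDecay, (1.11) p.573, dictionary] -/
def resR (g : ↥(fineDom ((ℓ + 1) ^ i.k) i.Ω₀c) × ι → ℝ) : ↥(fineDom ((ℓ + 1) ^ i.k) i.Ωc) × ι → ℝ :=
  fun q => g (incl (Nat.one_le_pow i.k (ℓ + 1) (Nat.succ_pos ℓ)) i.hsub q.1, q.2)

/-- `δG_k(Ω,Ω₀,A)f = G_k(Ω,A)f − (G_k(Ω₀,A)Ef)|Ω` (1.11). [cite: Balaban1983RegularityDecay, (1.11) p.573] -/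
abbrev deltaV (f : ↥(fineDom ((ℓ + 1) ^ i.k) i.Ωc) × ι → ℝ) : ↥(fineDom ((ℓ + 1) ^ i.k) i.Ωc) × ι → ℝ :=
  i.GΩ F *ᵥ f - i.resR (i.G₀ F *ᵥ i.extR f)

/-- the four vectors `Gf`, `D_μGf`, `GD_ν^*f`, `D_μGD_ν^*f` of (2.15)/(2.30) on `Ω`. [cite: Balaban1983RegularityDecay, (2.15) p.577, Cor. 2.3 (2.30) p.580, dictionary] -/
def opX (m : Fin 4) (μ ν : Fin (d + 1)) (f : ↥(fineDom ((ℓ + 1) ^ i.k) i.Ωc) × ι → ℝ) :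
    ↥(fineDom ((ℓ + 1) ^ i.k) i.Ωc) × ι → ℝ :=
  if m = 0 then i.GΩ F *ᵥ f else if m = 1 then i.DΩ F μ *ᵥ (i.GΩ F *ᵥ f)
  else if m = 2 then (i.GΩ F * (i.DΩ F ν)ᵀ) *ᵥ f else i.DΩ F μ *ᵥ ((i.GΩ F * (i.DΩ F ν)ᵀ) *ᵥ f)

/-- the same four vectors on `Ω₀`. [cite: Balaban1983RegularityDecay, (2.15) p.577, Cor. 2.3 (2.30) p.580, dictionary] -/
def opX₀ (m : Fin 4) (μ ν : Fin (d + 1)) (f : ↥(fineDom ((ℓ + 1) ^ i.k) i.Ω₀c) × ι → ℝ) :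
    ↥(fineDom ((ℓ + 1) ^ i.k) i.Ω₀c) × ι → ℝ :=
  if m = 0 then i.G₀ F *ᵥ f else if m = 1 then i.D₀ F μ *ᵥ (i.G₀ F *ᵥ f)
  else if m = 2 then (i.G₀ F * (i.D₀ F ν)ᵀ) *ᵥ f else i.D₀ F μ *ᵥ ((i.G₀ F * (i.D₀ F ν)ᵀ) *ᵥ f)

/-- the support of a source, as a set of sites. [cite: Balaban1983RegularityDecay, (1.9) p.573 «supp f», dictionary] -/
def supp (f : ↥(fineDom ((ℓ + 1) ^ i.k) i.Ωc) × ι → ℝ) : Finset ↥(fineDom ((ℓ + 1) ^ i.k) i.Ωc) :=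
  open Classical in Finset.univ.filter fun z => ∃ j, f (z, j) ≠ 0

/-- `dist(x, supp f)` in unit-lattice sup-norm units (`0` for `f = 0`). [cite: Balaban1983RegularityDecay, (1.10) p.573, dictionary] -/
def sdist1 (x : ↥(fineDom ((ℓ + 1) ^ i.k) i.Ωc)) (f : ↥(fineDom ((ℓ + 1) ^ i.k) i.Ωc) × ι → ℝ) : ℝ :=
  if h : (i.supp f).Nonempty then (i.supp f).inf' h (fun z => supNorm (x.1 - z.1) / (((ℓ + 1) ^ i.k : ℕ) : ℝ))
  else 0

/-- **`dist(x, Ω^c)`** in unit-lattice sup-norm units: the infimum over ALL points `z` of the fine lattice `ηℤ^{d+1}`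
outside `Ω`. [cite: Balaban1983RegularityDecay, Theorem p.573 «dist(x, Ω^c) ≥ R₀», (1.12), dictionary] -/
def cdist (x : ↥(fineDom ((ℓ + 1) ^ i.k) i.Ωc)) : ℝ :=
  ⨅ z : {z : Fin (d + 1) → ℤ // z ∉ fineDom ((ℓ + 1) ^ i.k) i.Ωc}, supNorm (x.1 - z.1) / (((ℓ + 1) ^ i.k : ℕ) : ℝ)

/-- `dist(supp f, Ω^c)` in unit-lattice sup-norm units (`0` for `f = 0`). [cite: Balaban1983RegularityDecay, (1.12) p.573, dictionary] -/
def bdistS (f : ↥(fineDom ((ℓ + 1) ^ i.k) i.Ωc) × ι → ℝ) : ℝ :=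
  if h : (i.supp f).Nonempty then (i.supp f).inf' h (fun z => i.cdist z) else 0

/-- `dist(supp f, supp f′)` in unit-lattice sup-norm units (Corollary 2.3's datum; `0` if a support is empty).
[cite: Balaban1983RegularityDecay, Corollary 2.3 (2.30) p.580, dictionary] -/
def ssdist (f f' : ↥(fineDom ((ℓ + 1) ^ i.k) i.Ωc) × ι → ℝ) : ℝ :=
  if h : (i.supp f ×ˢ i.supp f').Nonempty then
    (i.supp f ×ˢ i.supp f').inf' h (fun p => supNorm (p.1.1 - p.2.1) / (((ℓ + 1) ^ i.k : ℕ) : ℝ))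
  else 0

/-- THE ADMISSIBLE CONTOURS `Γ_{x,x′}` for the Hölder quotient in direction `μ`: the bonds `⟨x,x+ηe_μ⟩`,
`⟨x′,x′+ηe_μ⟩` lie in `Ω`, `x′ ≠ x`, and `Γ` is a nearest-neighbour chain OF `Ω` from `x` to `x′` with
`|Γ| ≤ (d+1)|x′−x|_∞` inside the `|x′−x|_∞`-ball about `x` (every shortest staircase contour inside `Ω` is one).
[cite: Balaban1983RegularityDecay, p.573 «let us denote by Γ_{x,x′} a shortest contour connecting these points», dictionary] -/
def Adm (μ : Fin (d + 1)) (x x' : ↥(fineDom ((ℓ + 1) ^ i.k) i.Ωc)) (l : List ↥(fineDom ((ℓ + 1) ^ i.k) i.Ωc)) : Prop :=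
  x.1 + e1 μ ∈ fineDom ((ℓ + 1) ^ i.k) i.Ωc ∧ x'.1 + e1 μ ∈ fineDom ((ℓ + 1) ^ i.k) i.Ωc ∧ x'.1 ≠ x.1 ∧
    IsNNChain x l ∧ pathEnd x l = x' ∧ (l.length : ℝ) ≤ ((d : ℝ) + 1) * supNorm (x'.1 - x.1) ∧
    ∀ z ∈ l, supNorm (z.1 - x.1) ≤ supNorm (x'.1 - x.1)

/-- the Hölder weight `|x − x′|^{-α}` in `η`-units: `(n/|x′−x|_∞)^α`. [cite: Balaban1983RegularityDecay, (1.9) p.573, dictionary] -/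
def wt (α : ℝ) (x x' : ↥(fineDom ((ℓ + 1) ^ i.k) i.Ωc)) : ℝ :=
  ((((ℓ + 1) ^ i.k : ℕ) : ℝ) / supNorm (x'.1 - x.1)) ^ α

/-- THE HÖLDER QUOTIENT of a field `v` between `x` and `x′` in direction `μ`:
`sup_Γ |x−x′|^{-α}|U(A(Γ))v(x′) − v(x)|` over the admissible contours (`0` if there is none).
[cite: Balaban1983RegularityDecay, (1.9) p.573] -/
def holderQ (α : ℝ) (μ : Fin (d + 1)) (v : ↥(fineDom ((ℓ + 1) ^ i.k) i.Ωc) × ι → ℝ)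
    (x x' : ↥(fineDom ((ℓ + 1) ^ i.k) i.Ωc)) : ℝ :=
  ⨆ (l : List ↥(fineDom ((ℓ + 1) ^ i.k) i.Ωc)), ⨆ (_ : i.Adm μ x x' l),
    i.wt α x x' * siteNorm (transport (fieldLink F i.κ (acBond i.Ωc i.Ac)) x l *ᵥ fld v x' - fld v x)

/-- a bound on every admissible quotient bounds the Hölder quotient. [cite: Balaban1983RegularityDecay, (1.9) p.573, dictionary] -/
theorem holderQ_le {α : ℝ} {μ : Fin (d + 1)} {v : ↥(fineDom ((ℓ + 1) ^ i.k) i.Ωc) × ι → ℝ}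
    {x x' : ↥(fineDom ((ℓ + 1) ^ i.k) i.Ωc)} {b : ℝ} (hb : 0 ≤ b)
    (h : ∀ l, i.Adm μ x x' l →
      i.wt α x x' * siteNorm (transport (fieldLink F i.κ (acBond i.Ωc i.Ac)) x l *ᵥ fld v x' - fld v x) ≤ b) :
    i.holderQ F α μ v x x' ≤ b :=
  Real.iSup_le (fun l => Real.iSup_le (fun hl => h l hl) hb) hb

omit [DecidableEq ι] in
/-- off the support the source vanishes. [cite: Balaban1983RegularityDecay, (1.9) p.573, dictionary] -/
theorem eq_zero_of_not_mem_supp (f : ↥(fineDom ((ℓ + 1) ^ i.k) i.Ωc) × ι → ℝ)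
    (p : ↥(fineDom ((ℓ + 1) ^ i.k) i.Ωc) × ι) (hp : p.1 ∉ i.supp f) : f p = 0 := by
  classical
  by_contra h
  exact hp (by unfold supp; exact Finset.mem_filter.mpr ⟨Finset.mem_univ _, p.2, h⟩)

omit [DecidableEq ι] in
/-- the component sup norm is below `‖f‖_∞ = sup_x |f(x)|`. [cite: Balaban1983RegularityDecay, (1.9) p.573 «‖f‖_∞», dictionary] -/
theorem norm_le_supN {X : Type} [Fintype X] (f : X × ι → ℝ) : ‖f‖ ≤ supN f := by
  refine (pi_norm_le_iff_of_nonneg (supN_nonneg f)).2 fun p => ?_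
  rw [Real.norm_eq_abs]
  exact (abs_apply_le_siteNorm' (fld f p.1) p.2).trans (le_supN f p.1)

omit [Fintype ι] [DecidableEq ι] in
/-- a sup-distance bound is attained along a coordinate. [folklore] -/
private theorem exists_coord_of_le_supNorm {u v : Fin (d + 1) → ℤ} {D : ℝ} (h : D ≤ supNorm (u - v)) :
    ∃ μ : Fin (d + 1), D ≤ |((u μ : ℤ) : ℝ) - ((v μ : ℤ) : ℝ)| := by
  obtain ⟨μ, hμ⟩ := exists_supNorm_eq (u - v)
  refine ⟨μ, ?_⟩
  rw [hμ, Pi.sub_apply, Int.cast_abs, Int.cast_sub] at h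
  exact h

omit [DecidableEq ι] in
/-- `dist(x, supp f) ≥ 0`. [cite: Balaban1983RegularityDecay, (1.10) p.573, dictionary] -/
theorem sdist1_nonneg (x : ↥(fineDom ((ℓ + 1) ^ i.k) i.Ωc)) (f : ↥(fineDom ((ℓ + 1) ^ i.k) i.Ωc) × ι → ℝ) :
    0 ≤ i.sdist1 x f := by
  unfold sdist1
  split_ifs with h
  · exact Finset.le_inf' _ _ fun z _ => div_nonneg (supNorm_nonneg _) (Nat.cast_nonneg _)
  · exact le_rfl

omit [DecidableEq ι] in
/-- `n·dist(x, supp f) ≤ |x_μ − z_μ|` along some coordinate, for `z ∈ supp f`. [cite: Balaban1983RegularityDecay, (1.10) p.573, dictionary] -/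
theorem sdist1_coord (x : ↥(fineDom ((ℓ + 1) ^ i.k) i.Ωc)) (f : ↥(fineDom ((ℓ + 1) ^ i.k) i.Ωc) × ι → ℝ)
    {z : ↥(fineDom ((ℓ + 1) ^ i.k) i.Ωc)} (hz : z ∈ i.supp f) {D : ℝ} (hD : D ≤ i.sdist1 x f) :
    ∃ μ : Fin (d + 1), D * (((ℓ + 1) ^ i.k : ℕ) : ℝ) ≤ |((x.1 μ : ℤ) : ℝ) - ((z.1 μ : ℤ) : ℝ)| := by
  have hnr : (0 : ℝ) < (((ℓ + 1) ^ i.k : ℕ) : ℝ) := by exact_mod_cast (Nat.one_le_pow i.k (ℓ + 1) (Nat.succ_pos ℓ))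
  refine exists_coord_of_le_supNorm ((mul_le_mul_of_nonneg_right hD hnr.le).trans ?_)
  unfold sdist1
  rw [dif_pos ⟨z, hz⟩, ← le_div_iff₀ hnr]
  exact Finset.inf'_le _ hz

omit [DecidableEq ι] in
/-- `dist(x, Ω^c) ≥ 0`. [cite: Balaban1983RegularityDecay, (1.12) p.573, dictionary] -/
theorem cdist_nonneg (x : ↥(fineDom ((ℓ + 1) ^ i.k) i.Ωc)) : 0 ≤ i.cdist x :=
  Real.iInf_nonneg fun _ => div_nonneg (supNorm_nonneg _) (Nat.cast_nonneg _)

omit [DecidableEq ι] in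
/-- `n·dist(x, Ω^c) ≤ |x − z|_∞` for every fine point `z ∉ Ω`. [cite: Balaban1983RegularityDecay, (1.12) p.573, dictionary] -/
theorem cdist_mul_le (x : ↥(fineDom ((ℓ + 1) ^ i.k) i.Ωc)) {z : Fin (d + 1) → ℤ}
    (hz : z ∉ fineDom ((ℓ + 1) ^ i.k) i.Ωc) :
    i.cdist x * (((ℓ + 1) ^ i.k : ℕ) : ℝ) ≤ supNorm (x.1 - z) := by
  have hnr : (0 : ℝ) < (((ℓ + 1) ^ i.k : ℕ) : ℝ) := by exact_mod_cast (Nat.one_le_pow i.k (ℓ + 1) (Nat.succ_pos ℓ))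
  rw [← le_div_iff₀ hnr]
  unfold cdist
  exact ciInf_le ⟨0, by rintro _ ⟨w, rfl⟩; exact div_nonneg (supNorm_nonneg _) (Nat.cast_nonneg _)⟩
    (⟨z, hz⟩ : {z : Fin (d + 1) → ℤ // z ∉ fineDom ((ℓ + 1) ^ i.k) i.Ωc})

omit [DecidableEq ι] in
/-- `n·D₀ ≤ |x_μ − x₁_μ|` along some coordinate for every site `x₁` of `Ω₀ ∖ Ω`, when `D₀ ≤ dist(x, Ω^c)`.
[cite: Balaban1983RegularityDecay, (1.12) p.573, dictionary] -/
theorem cdist_coord (x : ↥(fineDom ((ℓ + 1) ^ i.k) i.Ωc)) {D : ℝ} (hD : D ≤ i.cdist x)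
    (x₁ : ↥(fineDom ((ℓ + 1) ^ i.k) i.Ω₀c)) (hx₁ : ¬ inReg ((ℓ + 1) ^ i.k) i.Ωc x₁) :
    ∃ μ : Fin (d + 1), D * (((ℓ + 1) ^ i.k : ℕ) : ℝ) ≤ |((x.1 μ : ℤ) : ℝ) - ((x₁.1 μ : ℤ) : ℝ)| := by
  have hnr : (0 : ℝ) < (((ℓ + 1) ^ i.k : ℕ) : ℝ) := by exact_mod_cast (Nat.one_le_pow i.k (ℓ + 1) (Nat.succ_pos ℓ))
  have hz : x₁.1 ∉ fineDom ((ℓ + 1) ^ i.k) i.Ωc := fun h => hx₁ ((mem_fineDom (Nat.one_le_pow i.k (ℓ + 1) (Nat.succ_pos ℓ))).1 h)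
  exact exists_coord_of_le_supNorm ((mul_le_mul_of_nonneg_right hD hnr.le).trans (i.cdist_mul_le x hz))

omit [DecidableEq ι] in
/-- **THE PRINTED RESTRICTION IN LABEL FORM**: if `dist(x, Ω^c) ≥ R + 2` (unit-lattice units) then every unit label
within `R` of the block of `x` belongs to `Ω`. [cite: Balaban1983RegularityDecay, Theorem p.573 «dist(x, Ω^c) ≥ R₀», dictionary] -/
theorem labels_of_cdist (x : ↥(fineDom ((ℓ + 1) ^ i.k) i.Ωc)) {R : ℤ} (hR0 : 0 ≤ R)
    (hR : (R : ℝ) + 2 ≤ i.cdist x) (y : Fin (d + 1) → ℤ) (hy : ∀ ν, |y ν - blk ((ℓ + 1) ^ i.k) x.1 ν| ≤ R) :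
    y ∈ i.Ωc := by
  by_contra hyΩ
  have hn1 : 1 ≤ (ℓ + 1) ^ i.k := (Nat.one_le_pow i.k (ℓ + 1) (Nat.succ_pos ℓ))
  have hnr : (0 : ℝ) < (((ℓ + 1) ^ i.k : ℕ) : ℝ) := by exact_mod_cast hn1
  have hR0' : (0 : ℝ) ≤ R := by exact_mod_cast hR0
  -- the base point `n·y` of the block `B(y)` lies outside `Ω`
  have hzΩ : (fun j => (((ℓ + 1) ^ i.k : ℕ) : ℤ) * y j) ∉ fineDom ((ℓ + 1) ^ i.k) i.Ωc := by
    intro h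
    have := (mem_fineDom hn1).1 h
    rw [blk_mul hn1] at this
    exact hyΩ this
  have h1 := i.cdist_mul_le x hzΩ
  -- `|x − n·y|_∞ ≤ n(R + 1)`
  obtain ⟨μ, hμ⟩ := exists_supNorm_eq (x.1 - fun j => (((ℓ + 1) ^ i.k : ℕ) : ℤ) * y j)
  obtain ⟨hlow, hup⟩ := base_le_of_blk hn1 (rfl : blk ((ℓ + 1) ^ i.k) x.1 = blk ((ℓ + 1) ^ i.k) x.1)
  have a1 : (((ℓ + 1) ^ i.k : ℕ) : ℝ) * ((blk ((ℓ + 1) ^ i.k) x.1 μ : ℤ) : ℝ) ≤ ((x.1 μ : ℤ) : ℝ) := by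
    exact_mod_cast hlow μ
  have a2 : ((x.1 μ : ℤ) : ℝ) - (((ℓ + 1) ^ i.k : ℕ) : ℝ) * ((blk ((ℓ + 1) ^ i.k) x.1 μ : ℤ) : ℝ)
      ≤ (((ℓ + 1) ^ i.k : ℕ) : ℝ) := by
    exact_mod_cast hup μ
  have hyμ : |((y μ : ℤ) : ℝ) - ((blk ((ℓ + 1) ^ i.k) x.1 μ : ℤ) : ℝ)| ≤ (R : ℝ) := by
    rw [← Int.cast_sub, ← Int.cast_abs]; exact_mod_cast hy μ
  obtain ⟨h3, h4⟩ := abs_le.mp hyμ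
  have h5 := mul_le_mul_of_nonneg_left h4 hnr.le
  have h6 := mul_le_mul_of_nonneg_left h3 hnr.le
  have hsup : supNorm (x.1 - fun j => (((ℓ + 1) ^ i.k : ℕ) : ℤ) * y j) ≤ (((ℓ + 1) ^ i.k : ℕ) : ℝ) * (R + 1) := by
    rw [hμ, Int.cast_abs, Pi.sub_apply, Int.cast_sub, Int.cast_mul, Int.cast_natCast, abs_le]
    constructor <;> nlinarith [h5, h6, a1, a2]
  have h2 : i.cdist x * (((ℓ + 1) ^ i.k : ℕ) : ℝ) ≤ (((ℓ + 1) ^ i.k : ℕ) : ℝ) * (R + 1) := h1.trans hsup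
  have h7 : i.cdist x ≤ R + 1 := by
    rw [mul_comm] at h2
    exact le_of_mul_le_mul_left h2 hnr
  linarith

omit [DecidableEq ι] in
/-- `dist(supp f, Ω^c) ≥ 0`. [cite: Balaban1983RegularityDecay, (1.12) p.573, dictionary] -/
theorem bdistS_nonneg (f : ↥(fineDom ((ℓ + 1) ^ i.k) i.Ωc) × ι → ℝ) : 0 ≤ i.bdistS f := by
  unfold bdistS
  split_ifs with h
  · exact Finset.le_inf' _ _ fun z _ => i.cdist_nonneg z
  · exact le_rfl

omit [DecidableEq ι] in
/-- `dist(supp f, Ω^c) ≤ dist(z, Ω^c)` for `z ∈ supp f`. [cite: Balaban1983RegularityDecay, (1.12) p.573, dictionary] -/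
theorem bdistS_le (f : ↥(fineDom ((ℓ + 1) ^ i.k) i.Ωc) × ι → ℝ) {z : ↥(fineDom ((ℓ + 1) ^ i.k) i.Ωc)}
    (hz : z ∈ i.supp f) : i.bdistS f ≤ i.cdist z := by
  unfold bdistS
  rw [dif_pos ⟨z, hz⟩]
  exact Finset.inf'_le _ hz

omit [Fintype ι] [DecidableEq ι] in
/-- restriction after extension by zero is the identity. [cite: Balaban1983RegularityDecay, (1.11) p.573, dictionary] -/
theorem resR_extR (f : ↥(fineDom ((ℓ + 1) ^ i.k) i.Ωc) × ι → ℝ) : i.resR (i.extR f) = f := by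
  funext q
  have hq : inReg ((ℓ + 1) ^ i.k) i.Ωc (incl (Nat.one_le_pow i.k (ℓ + 1) (Nat.succ_pos ℓ)) i.hsub q.1) := (mem_fineDom (Nat.one_le_pow i.k (ℓ + 1) (Nat.succ_pos ℓ))).1 q.1.2
  simp only [resR, extR, dif_pos hq]
  rfl

omit [Fintype ι] [DecidableEq ι] in
/-- the extension vanishes off `Ω`. [cite: Balaban1983RegularityDecay, (1.11) p.573, dictionary] -/
theorem extR_of_not_inReg (f : ↥(fineDom ((ℓ + 1) ^ i.k) i.Ωc) × ι → ℝ)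
    (p : ↥(fineDom ((ℓ + 1) ^ i.k) i.Ω₀c) × ι) (hp : ¬ inReg ((ℓ + 1) ^ i.k) i.Ωc p.1) : i.extR f p = 0 := by
  simp only [extR, dif_neg hp]

omit [Fintype ι] [DecidableEq ι] in
/-- the extension at a site of `Ω`. [cite: Balaban1983RegularityDecay, (1.11) p.573, dictionary] -/
theorem extR_incl (f : ↥(fineDom ((ℓ + 1) ^ i.k) i.Ωc) × ι → ℝ) (z : ↥(fineDom ((ℓ + 1) ^ i.k) i.Ωc)) (j : ι) :
    i.extR f (incl (Nat.one_le_pow i.k (ℓ + 1) (Nat.succ_pos ℓ)) i.hsub z, j) = f (z, j) := by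
  have h := congrFun (i.resR_extR f) (z, j)
  exact h

omit [DecidableEq ι] in
/-- `‖Ef‖_∞ ≤ ‖f‖_∞` (component sup norms). [cite: Balaban1983RegularityDecay, (1.11) p.573, dictionary] -/
theorem norm_extR_le (f : ↥(fineDom ((ℓ + 1) ^ i.k) i.Ωc) × ι → ℝ) : ‖i.extR f‖ ≤ ‖f‖ := by
  refine (pi_norm_le_iff_of_nonneg (norm_nonneg f)).2 fun p => ?_
  by_cases hp : inReg ((ℓ + 1) ^ i.k) i.Ωc p.1
  · simp only [extR, dif_pos hp]
    exact norm_le_pi_norm f _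
  · rw [i.extR_of_not_inReg f p hp, norm_zero]
    exact norm_nonneg f

/-- the covariant derivative vanishes at a site whose forward bond leaves `Ω` (Neumann). [cite: Balaban1983RegularityDecay, (1.3) p.572, dictionary] -/
theorem fld_DΩ_eq_zero (μ : Fin (d + 1)) (v : ↥(fineDom ((ℓ + 1) ^ i.k) i.Ωc) × ι → ℝ)
    (x : ↥(fineDom ((ℓ + 1) ^ i.k) i.Ωc)) (hx : x.1 + e1 μ ∉ fineDom ((ℓ + 1) ^ i.k) i.Ωc) :
    fld (i.DΩ F μ *ᵥ v) x = 0 :=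
  fld_covDeriv_mulVec_of_not_mem ((ℓ + 1) ^ i.k) (fieldLink F (i.e / ((ℓ + 1) ^ i.k : ℕ)) (acBond i.Ωc i.Ac)) v hx

/-- the derivative on `Ω` of a restricted field is the restriction of the derivative on `Ω₀`, on a bond of `Ω`.
[cite: Balaban1983RegularityDecay, (1.3) p.572, (1.11) p.573, dictionary] -/
theorem DΩ_resR_apply (μ : Fin (d + 1)) (w : ↥(fineDom ((ℓ + 1) ^ i.k) i.Ω₀c) × ι → ℝ)
    (x : ↥(fineDom ((ℓ + 1) ^ i.k) i.Ωc)) (hx : x.1 + e1 μ ∈ fineDom ((ℓ + 1) ^ i.k) i.Ωc) (j : ι) :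
    (i.DΩ F μ *ᵥ i.resR w) (x, j) = (i.D₀ F μ *ᵥ w) (incl (Nat.one_le_pow i.k (ℓ + 1) (Nat.succ_pos ℓ)) i.hsub x, j) := by
  have hx' : (incl (Nat.one_le_pow i.k (ℓ + 1) (Nat.succ_pos ℓ)) i.hsub x).1 + e1 μ ∈ fineDom ((ℓ + 1) ^ i.k) i.Ω₀c :=
    B4RegionCubeCarrier.fineDom_mono (Nat.one_le_pow i.k (ℓ + 1) (Nat.succ_pos ℓ)) i.hsub hx
  have h1 := congrFun (fld_covDeriv_mulVec_of_mem ((ℓ + 1) ^ i.k)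
    (fieldLink F (i.e / ((ℓ + 1) ^ i.k : ℕ)) (acBond i.Ωc i.Ac)) (μ := μ) (i.resR w) (x := x) hx) j
  have h2 := congrFun (fld_covDeriv_mulVec_of_mem ((ℓ + 1) ^ i.k)
    (fieldLink F (i.e / ((ℓ + 1) ^ i.k : ℕ)) (acBond i.Ω₀c i.Ac)) (μ := μ) w (x := incl (Nat.one_le_pow i.k (ℓ + 1) (Nat.succ_pos ℓ)) i.hsub x) hx') j
  rw [fld_apply] at h1 h2
  have hder : ∀ R : Finset (Fin (d + 1) → ℤ), regionDeriv F i.e ((ℓ + 1) ^ i.k) R i.Ac μ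
      = covDeriv ((ℓ + 1) ^ i.k) (fineDom ((ℓ + 1) ^ i.k) R)
          (fieldLink F (i.e / ((ℓ + 1) ^ i.k : ℕ)) (acBond R i.Ac)) μ := fun R => rfl
  show (regionDeriv F i.e ((ℓ + 1) ^ i.k) i.Ωc i.Ac μ *ᵥ i.resR w) (x, j)
    = (regionDeriv F i.e ((ℓ + 1) ^ i.k) i.Ω₀c i.Ac μ *ᵥ w) (incl (Nat.one_le_pow i.k (ℓ + 1) (Nat.succ_pos ℓ)) i.hsub x, j)
  rw [hder, hder, h1, h2]
  rfl

/-- `δG_kf` evaluated: `(δG_kf)(x) = (G_k(Ω,A)f)(x) − (G_k(Ω₀,A)Ef)(x)`. [cite: Balaban1983RegularityDecay, (1.11) p.573] -/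
theorem fld_deltaV_apply (f : ↥(fineDom ((ℓ + 1) ^ i.k) i.Ωc) × ι → ℝ) (x : ↥(fineDom ((ℓ + 1) ^ i.k) i.Ωc))
    (j : ι) :
    fld (i.deltaV F f) x j = (i.GΩ F *ᵥ f) (x, j) - (i.G₀ F *ᵥ i.extR f) (incl (Nat.one_le_pow i.k (ℓ + 1) (Nat.succ_pos ℓ)) i.hsub x, j) := rfl

/-- `D^η_{A,μ}δG_kf` on a bond of `Ω`: `(D_μ G_k(Ω,A)f)(x) − (D_μ G_k(Ω₀,A)Ef)(x)`. [cite: Balaban1983RegularityDecay, (1.3) p.572, (1.11) p.573] -/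
theorem fld_DΩ_deltaV_apply (μ : Fin (d + 1)) (f : ↥(fineDom ((ℓ + 1) ^ i.k) i.Ωc) × ι → ℝ)
    (x : ↥(fineDom ((ℓ + 1) ^ i.k) i.Ωc)) (hx : x.1 + e1 μ ∈ fineDom ((ℓ + 1) ^ i.k) i.Ωc) (j : ι) :
    fld (i.DΩ F μ *ᵥ i.deltaV F f) x j
      = (i.DΩ F μ *ᵥ (i.GΩ F *ᵥ f)) (x, j) - (i.D₀ F μ *ᵥ (i.G₀ F *ᵥ i.extR f)) (incl (Nat.one_le_pow i.k (ℓ + 1) (Nat.succ_pos ℓ)) i.hsub x, j) := by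
  rw [fld_apply, Matrix.mulVec_sub, Pi.sub_apply, i.DΩ_resR_apply F μ _ x hx j]

end RegionPairInst

/-- **THE FAMILY OF SETTINGS OF THE THEOREM ON GENERAL PAIRS `Ω ⊂ Ω₀` OF FINITE UNIONS OF BIG BLOCKS AT A
(1.7)-REGULAR FIELD**: b04's `B4.EtaSetting` filled with the printed objects on `Ω` (module docstring); parameters: the
flow, `d`, `ℓ` (`L = ℓ+1`), the windows, the (1.7) constants `(c, β)` and the big-block size `K`; `rect := False`
(the `R₀` restriction of the print is imposed). [cite: Balaban1983RegularityDecay, (1.7) p.572, Theorem (1.9)–(1.12) p.573] -/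
def regionPairFam (F : OrthFlow ι) (d ℓ : ℕ) (amin aplus m2plus creg β : ℝ) (K : ℕ)
    (i : RegionPairInst d ℓ amin aplus m2plus) : EtaSetting where
  Site := ↥(fineDom ((ℓ + 1) ^ i.k) i.Ωc)
  Dir := Fin (d + 1)
  Src := ↥(fineDom ((ℓ + 1) ^ i.k) i.Ωc) × ι → ℝ
  e := i.e
  regular := ∀ x ∈ fineDom ((ℓ + 1) ^ i.k) i.Ω₀c, ∀ μ ν : Fin (d + 1),
    |i.Ac (x + e1 μ) ν - i.Ac x ν| ≤ creg * i.e ^ (β - 1) / ((ℓ + 1) ^ i.k : ℕ)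
  bigBlocks := IsBlockUnion K i.Ω₀c ∧ IsBlockUnion K i.Ωc
  rect := False
  pdist := fun x y => supNorm (x.1 - y.1) / (((ℓ + 1) ^ i.k : ℕ) : ℝ)
  sdist1 := i.sdist1
  sdist2 := fun x x' f => min (i.sdist1 x f) (i.sdist1 x' f)
  bdist1 := i.cdist
  bdist2 := fun x x' => min (i.cdist x) (i.cdist x')
  bdistS := i.bdistS
  supNorm := fun f => supN f
  l2Norm := fun f => Real.sqrt (∑ p, f p ^ 2)
  ssdist := i.ssdist
  lhs19 := fun α μ f x x' => i.holderQ F α μ (i.DΩ F μ *ᵥ (i.GΩ F *ᵥ f)) x x'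
  valDG := fun μ f x => siteNorm (fld (i.DΩ F μ *ᵥ (i.GΩ F *ᵥ f)) x)
  valG := fun f x => siteNorm (fld (i.GΩ F *ᵥ f) x)
  dlhs19 := fun α μ f x x' => i.holderQ F α μ (i.DΩ F μ *ᵥ i.deltaV F f) x x'
  dvalDG := fun μ f x => siteNorm (fld (i.DΩ F μ *ᵥ i.deltaV F f) x)
  dvalG := fun f x => siteNorm (fld (i.deltaV F f) x)
  lower18 := fun γ => ∀ v : ↥(fineDom ((ℓ + 1) ^ i.k) i.Ωc) × ι → ℝ,
    γ * (v ⬝ᵥ v) ≤ v ⬝ᵥ (regionOp F i.e (Nat.one_le_pow i.k (ℓ + 1) (Nat.succ_pos ℓ)) (B1.aSeq i.a ((ℓ : ℝ) + 1) i.k) i.m2 i.Ωc i.Ac *ᵥ v)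
  pair := fun m μ ν f' f => |f' ⬝ᵥ i.opX F m μ ν f|
  dpair := fun m μ ν f' f => |f' ⬝ᵥ (i.opX F m μ ν f - i.resR (i.opX₀ F m μ ν (i.extR f)))|

/-- THE BIG-BLOCK SIZE `K` of the side condition `bigBlocks` (the `K` of `region_pair_members`; it does not depend on
`α`). [cite: Balaban1983RegularityDecay, p.572 «cubes of size M called big blocks», dictionary] -/
def Kmod (F : OrthFlow ι) {ℓ₁ : ℝ} (hℓ₁ : 0 ≤ ℓ₁)
    (hLip : ∀ t (v : ι → ℝ), ((F.U t - 1) *ᵥ v) ⬝ᵥ ((F.U t - 1) *ᵥ v) ≤ (ℓ₁ * t) ^ 2 * (v ⬝ᵥ v))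
    (d ℓ : ℕ) (hℓ : 1 ≤ ℓ) (amin aplus m2plus : ℝ) (ha : 0 < amin) : ℕ :=
  Classical.choose (region_pair_members F hℓ₁ hLip d ℓ hℓ amin aplus m2plus ha)

/-- **NON-VACUITY**: for every block size `K ≥ 1` and threshold `e₁ > 0` there are instances satisfying `regular`,
`bigBlocks` and `0 < e ≤ e₁` (e.g. `A_c = 0`, `Ω = Ω₀ =` one `K`-cube of unit labels at scale `k = 1`).
[cite: Balaban1983RegularityDecay, Theorem p.573, dictionary] -/
theorem hypotheses_met (F : OrthFlow ι) (d ℓ : ℕ) {amin aplus m2plus : ℝ} (hap : amin ≤ aplus) (hm : 0 ≤ m2plus)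
    (creg β : ℝ) (hcreg : 0 ≤ creg) (K : ℕ) (hK : 1 ≤ K) (e₁ : ℝ) (he₁ : 0 < e₁) :
    ∃ i : RegionPairInst d ℓ amin aplus m2plus,
      (regionPairFam F d ℓ amin aplus m2plus creg β K i).regular ∧
      (regionPairFam F d ℓ amin aplus m2plus creg β K i).bigBlocks ∧
      0 < (regionPairFam F d ℓ amin aplus m2plus creg β K i).e ∧
      (regionPairFam F d ℓ amin aplus m2plus creg β K i).e ≤ e₁ := by
  let i0 : RegionPairInst d ℓ amin aplus m2plus :=
    { k := 1
      hk := le_rfl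
      Ω₀c := fineDom K {0}
      Ωc := fineDom K {0}
      hsub := Finset.Subset.refl _
      a := amin
      m2 := 0
      ha1 := le_rfl
      ha2 := hap
      hm1 := le_rfl
      hm2 := hm
      Ac := fun _ _ => 0
      e := e₁ }
  refine ⟨i0, ?_, ⟨fineDom_isBlockUnion hK _, fineDom_isBlockUnion hK _⟩, he₁, le_rfl⟩
  intro x _ μ ν
  change |(0 : ℝ) - 0| ≤ creg * e₁ ^ (β - 1) / ((ℓ + 1) ^ 1 : ℕ)
  rw [sub_self, abs_zero]
  positivity

/-! ## §3. The Theorem on the family -/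

/-- **THEOREM p. 573, (1.9)–(1.12), ON THE FAMILY OF GENERAL PAIRS `Ω ⊂ Ω₀` OF FINITE UNIONS OF BIG BLOCKS AT A
(1.7)-REGULAR FIELD, IN THE TYPED `η`-UNIFORM FORM `ThmPrintedNN`.**  For the family `regionPairFam` (block size
`K = Kmod`): for every `0 ≤ α < 1` there are `δ₀, c₀, R₀, e₁ > 0` such that for every instance whose field is
(1.7)-regular on `Ω₀` (constants `(c,β)`), whose `Ω`, `Ω₀` are unions of `K`-blocks, and whose coupling is `0 < e ≤ e₁`,
the inequalities (1.9)–(1.10) hold for `G_k(Ω,A)` and (1.9)–(1.10) with the factor (1.12) hold for `δG_k(Ω,Ω₀,A)`, at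
all `x, x′ ∈ Ω` with `dist({x,x′}, Ω^c) ≥ R₀` (resp. `dist(x, Ω^c) ≥ R₀`) — `Ineq19_110 ∧ Ineq111_112` at
`(α, δ₀, c₀, R₀)`, `δ₀ = (4K)⁻¹`, `R₀ = K(d+4) + 2`.  Print: p. 573 constants «independent of A, k, Ω», «If Ω ⊂ Ω₀,
then for δG_k(Ω, Ω₀, A) …»; p. 572 «We consider subsets Ω which are unions of big blocks.»
[cite: Balaban1983RegularityDecay, Theorem (1.9)–(1.12) p.573] -/
theorem thmPrintedNN_regionPairFam (F : OrthFlow ι) {ℓ₁ : ℝ} (hℓ₁ : 0 ≤ ℓ₁)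
    (hLip : ∀ t (v : ι → ℝ), ((F.U t - 1) *ᵥ v) ⬝ᵥ ((F.U t - 1) *ᵥ v) ≤ (ℓ₁ * t) ^ 2 * (v ⬝ᵥ v))
    (d ℓ : ℕ) (hℓ : 1 ≤ ℓ) (amin aplus m2plus : ℝ) (ha : 0 < amin) (creg β : ℝ) (hcreg : 0 ≤ creg)
    (hβ : 0 < β) :
    ThmPrintedNN (regionPairFam F d ℓ amin aplus m2plus creg β (Kmod F hℓ₁ hLip d ℓ hℓ amin aplus m2plus ha)) := by
  intro α hα0 hα1
  classical
  obtain ⟨hK16, HC⟩ := Classical.choose_spec (region_pair_members F hℓ₁ hLip d ℓ hℓ amin aplus m2plus ha)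
  set K : ℕ := Kmod F hℓ₁ hLip d ℓ hℓ amin aplus m2plus ha with hKdef
  have hKeq : Classical.choose (region_pair_members F hℓ₁ hLip d ℓ hℓ amin aplus m2plus ha) = K := rfl
  rw [hKeq] at hK16 HC
  have hKr : (0 : ℝ) < K := by exact_mod_cast lt_of_lt_of_le (by norm_num) hK16
  obtain ⟨C, hC, HC'⟩ := HC α hα0 hα1
  obtain ⟨e₁, he₁, H⟩ := HC' creg β hcreg hβ
  set N2 : ℝ := Real.sqrt (Fintype.card ι) with hN2
  have hN2 : 0 ≤ N2 := Real.sqrt_nonneg _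
  set δ₀ : ℝ := 1 / (4 * K) with hδ₀
  have hδ₀0 : 0 < δ₀ := by positivity
  set c₀ : ℝ := N2 * C + 1 with hc₀
  have hc₀0 : 0 < c₀ := by positivity
  have hNC : N2 * C ≤ c₀ := by rw [hc₀]; linarith only
  set R₀ : ℝ := (K : ℝ) * ((d : ℝ) + 4) + 2 with hR₀
  have hR₀0 : 0 < R₀ := by positivity
  refine ⟨δ₀, c₀, R₀, e₁, hδ₀0, hc₀0, hR₀0, he₁, ?_⟩
  intro i hreg hbig he hle
  dsimp only [regionPairFam] at hreg hbig he hle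
  obtain ⟨hΩ₀, hΩ⟩ := hbig
  obtain ⟨V, Dm, Hm, dV, dD, dH⟩ := H i.k i.hk (Nat.one_le_pow i.k (ℓ + 1) (Nat.succ_pos ℓ)) i.a i.m2 i.ha1 i.ha2 i.hm1 i.hm2 i.Ω₀c i.Ωc hΩ₀ hΩ i.hsub
    i.Ac i.e he hle hreg
  have hn1 : 1 ≤ (ℓ + 1) ^ i.k := (Nat.one_le_pow i.k (ℓ + 1) (Nat.succ_pos ℓ))
  have hnr : (0 : ℝ) < (((ℓ + 1) ^ i.k : ℕ) : ℝ) := by exact_mod_cast hn1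
  -- the label-form `R₀` condition from `dist(x, Ω^c) ≥ R₀`
  have hRint : (0 : ℤ) ≤ (K : ℤ) * (d + 4) := by positivity
  have hlab : ∀ x : ↥(fineDom ((ℓ + 1) ^ i.k) i.Ωc), R₀ ≤ i.cdist x →
      ∀ y : Fin (d + 1) → ℤ, (∀ ν, |y ν - blk ((ℓ + 1) ^ i.k) x.1 ν| ≤ (K : ℤ) * (d + 4)) → y ∈ i.Ωc := by
    intro x hx y hy
    refine i.labels_of_cdist x hRint (le_trans (le_of_eq ?_) hx) y hy
    rw [hR₀]; push_cast; try ring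
  -- the exponential conversions (fine distances `n·D`)
  have hexp1 : ∀ {D : ℝ}, Real.exp (-((D * (((ℓ + 1) ^ i.k : ℕ) : ℝ)) / (4 * ((((ℓ + 1) ^ i.k : ℕ) : ℝ) * K)))) = Real.exp (-(δ₀ * D)) := by
    intro D
    congr 1
    rw [hδ₀]
    field_simp
  have hexp2 : ∀ D Db Df : ℝ, Real.exp (-((Db * (((ℓ + 1) ^ i.k : ℕ) : ℝ) + Df * (((ℓ + 1) ^ i.k : ℕ) : ℝ)) / (4 * ((((ℓ + 1) ^ i.k : ℕ) : ℝ) * K)))) *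
      Real.exp (-((D * (((ℓ + 1) ^ i.k : ℕ) : ℝ)) / (4 * ((((ℓ + 1) ^ i.k : ℕ) : ℝ) * K)))) = Real.exp (-(δ₀ * D)) * Real.exp (-(δ₀ * Db + δ₀ * Df)) := by
    intro D Db Df
    rw [← Real.exp_add, ← Real.exp_add]
    congr 1
    rw [hδ₀]
    field_simp
    ring
  -- sources: support, sup norm
  have hsrc : ∀ f : ↥(fineDom ((ℓ + 1) ^ i.k) i.Ωc) × ι → ℝ,
      (∀ p : ↥(fineDom ((ℓ + 1) ^ i.k) i.Ωc) × ι, ¬ (p.1 ∈ i.supp f) → f p = 0) ∧ ‖f‖ ≤ supN f :=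
    fun f => ⟨fun p hp => i.eq_zero_of_not_mem_supp f p hp, RegionPairInst.norm_le_supN f⟩
  -- the support of the extension and its distances
  have hsrcE : ∀ f : ↥(fineDom ((ℓ + 1) ^ i.k) i.Ωc) × ι → ℝ, ∀ p : ↥(fineDom ((ℓ + 1) ^ i.k) i.Ω₀c) × ι,
      ¬ (∃ z ∈ i.supp f, incl (Nat.one_le_pow i.k (ℓ + 1) (Nat.succ_pos ℓ)) i.hsub z = p.1) → i.extR f p = 0 := by
    rintro f ⟨p1, j⟩ hp
    by_cases hq : inReg ((ℓ + 1) ^ i.k) i.Ωc p1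
    · obtain ⟨z, hz⟩ := (B4RegionCubeCarrier.inReg_iff (Nat.one_le_pow i.k (ℓ + 1) (Nat.succ_pos ℓ)) i.hsub p1).1 hq
      have hzs : z ∉ i.supp f := fun h => hp ⟨z, h, hz⟩
      subst hz
      rw [i.extR_incl f z j]
      exact i.eq_zero_of_not_mem_supp f (z, j) hzs
    · exact i.extR_of_not_inReg f (p1, j) hq
  -- distances ↦ hypotheses of the members
  have hDs : ∀ (f : ↥(fineDom ((ℓ + 1) ^ i.k) i.Ωc) × ι → ℝ) (x : ↥(fineDom ((ℓ + 1) ^ i.k) i.Ωc)) (D : ℝ), D ≤ i.sdist1 x f →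
      ∀ x'', x'' ∈ i.supp f → ∃ μ, D * (((ℓ + 1) ^ i.k : ℕ) : ℝ) ≤ |rpos ((ℓ + 1) ^ i.k) i.Ωc x μ - rpos ((ℓ + 1) ^ i.k) i.Ωc x'' μ| :=
    fun f x D hD x'' hx'' => i.sdist1_coord x f hx'' hD
  have hDsE : ∀ (f : ↥(fineDom ((ℓ + 1) ^ i.k) i.Ωc) × ι → ℝ) (x : ↥(fineDom ((ℓ + 1) ^ i.k) i.Ωc)) (D : ℝ), D ≤ i.sdist1 x f →
      ∀ p : ↥(fineDom ((ℓ + 1) ^ i.k) i.Ω₀c), (∃ z ∈ i.supp f, incl (Nat.one_le_pow i.k (ℓ + 1) (Nat.succ_pos ℓ)) i.hsub z = p) →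
      ∃ μ, D * (((ℓ + 1) ^ i.k : ℕ) : ℝ) ≤ |rpos ((ℓ + 1) ^ i.k) i.Ω₀c (incl (Nat.one_le_pow i.k (ℓ + 1) (Nat.succ_pos ℓ)) i.hsub x) μ - rpos ((ℓ + 1) ^ i.k) i.Ω₀c p μ| := by
    intro f x D hD p hp
    obtain ⟨z, hz, rfl⟩ := hp
    exact i.sdist1_coord x f hz hD
  have hDb : ∀ (x : ↥(fineDom ((ℓ + 1) ^ i.k) i.Ωc)) (Db : ℝ), Db ≤ i.cdist x → ∀ x₁ : ↥(fineDom ((ℓ + 1) ^ i.k) i.Ω₀c),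
      ¬ inReg ((ℓ + 1) ^ i.k) i.Ωc x₁ → ∃ μ, Db * (((ℓ + 1) ^ i.k : ℕ) : ℝ) ≤ |rpos ((ℓ + 1) ^ i.k) i.Ω₀c (incl (Nat.one_le_pow i.k (ℓ + 1) (Nat.succ_pos ℓ)) i.hsub x) μ - rpos ((ℓ + 1) ^ i.k) i.Ω₀c x₁ μ| :=
    fun x Db hDb x₁ hx₁ => i.cdist_coord x hDb x₁ hx₁
  have hDf : ∀ (f : ↥(fineDom ((ℓ + 1) ^ i.k) i.Ωc) × ι → ℝ) (p : ↥(fineDom ((ℓ + 1) ^ i.k) i.Ω₀c)), (∃ z ∈ i.supp f, incl (Nat.one_le_pow i.k (ℓ + 1) (Nat.succ_pos ℓ)) i.hsub z = p) →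
      ∀ x₁ : ↥(fineDom ((ℓ + 1) ^ i.k) i.Ω₀c), ¬ inReg ((ℓ + 1) ^ i.k) i.Ωc x₁ →
      ∃ μ, i.bdistS f * (((ℓ + 1) ^ i.k : ℕ) : ℝ) ≤ |rpos ((ℓ + 1) ^ i.k) i.Ω₀c x₁ μ - rpos ((ℓ + 1) ^ i.k) i.Ω₀c p μ| := by
    intro f p hp x₁ hx₁
    obtain ⟨z, hz, rfl⟩ := hp
    obtain ⟨μ, hμ⟩ := i.cdist_coord z (i.bdistS_le f hz) x₁ hx₁
    exact ⟨μ, hμ.trans (le_of_eq (abs_sub_comm _ _))⟩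
  -- vector bounds from component bounds
  have hvec : ∀ (v : ι → ℝ) {b : ℝ}, 0 ≤ b → (∀ j, |v j| ≤ C * b) → siteNorm v ≤ c₀ * b := by
    intro v b hb hv
    refine (siteNorm_le_sqrt_card_mul v (by positivity) hv).trans ?_
    rw [← mul_assoc]
    exact mul_le_mul_of_nonneg_right hNC hb
  have hvecw : ∀ (w : ℝ) (v : ι → ℝ) {b : ℝ}, 0 ≤ w → 0 ≤ b → (∀ j, w * |v j| ≤ C * b) → w * siteNorm v ≤ c₀ * b := by
    intro w v b hw hb hv
    have : w * siteNorm v = siteNorm (w • v) := by rw [siteNorm_smul, abs_of_nonneg hw]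
    rw [this]
    refine hvec (w • v) hb fun j => ?_
    rw [Pi.smul_apply, smul_eq_mul, abs_mul, abs_of_nonneg hw]
    exact hv j
  dsimp only [Ineq19_110, Ineq111_112, regionPairFam]
  refine ⟨⟨?_, ?_⟩, ⟨?_, ?_⟩⟩
  ---------------------------------------------------------------- (1.9) on `Ω`
  · intro μ f x x' hR
    rcases hR with hR | hR
    · exact hR.elim
    obtain ⟨hfP, hφ⟩ := hsrc f
    clear V Dm dV dD dH
    show i.holderQ F α μ (i.DΩ F μ *ᵥ (i.GΩ F *ᵥ f)) x x'
      ≤ c₀ * Real.exp (-(δ₀ * min (i.sdist1 x f) (i.sdist1 x' f))) * supN f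
    have hD0 : 0 ≤ min (i.sdist1 x f) (i.sdist1 x' f) := le_min (i.sdist1_nonneg x f) (i.sdist1_nonneg x' f)
    have hb0 : 0 ≤ Real.exp (-(δ₀ * min (i.sdist1 x f) (i.sdist1 x' f))) * supN f :=
      mul_nonneg (Real.exp_pos _).le (supN_nonneg f)
    refine i.holderQ_le F (mul_nonneg (mul_nonneg hc₀0.le (Real.exp_pos _).le) (supN_nonneg f)) fun l hl => ?_
    obtain ⟨hx, hx', hne, hch, hend, hlen, hnear⟩ := hl
    have hw0 : 0 ≤ i.wt α x x' := Real.rpow_nonneg (div_nonneg hnr.le (supNorm_nonneg _)) α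
    have := hvecw (i.wt α x x') _ hw0 hb0 fun j => by
      have h := Hm μ x x' hx hx' hne l hch hend hlen hnear (hlab x (hR.trans (min_le_left _ _)))
        (hlab x' (hR.trans (min_le_right _ _))) (fun z => z ∈ i.supp f)
        (min (i.sdist1 x f) (i.sdist1 x' f) * (((ℓ + 1) ^ i.k : ℕ) : ℝ)) (mul_nonneg hD0 hnr.le)
        (hDs f x _ (min_le_left _ _)) (hDs f x' _ (min_le_right _ _)) f hfP j
      rw [hexp1] at h
      calc i.wt α x x' * |(transport (fieldLink F i.κ (acBond i.Ωc i.Ac)) x l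
              *ᵥ fld (i.DΩ F μ *ᵥ (i.GΩ F *ᵥ f)) x' - fld (i.DΩ F μ *ᵥ (i.GΩ F *ᵥ f)) x) j|
          ≤ C * Real.exp (-(δ₀ * min (i.sdist1 x f) (i.sdist1 x' f))) * ‖f‖ := h
        _ ≤ C * (Real.exp (-(δ₀ * min (i.sdist1 x f) (i.sdist1 x' f))) * supN f) := by
            rw [mul_assoc]; exact mul_le_mul_of_nonneg_left (mul_le_mul_of_nonneg_left hφ (Real.exp_pos _).le) hC.le
    calc i.wt α x x' * siteNorm (transport (fieldLink F i.κ (acBond i.Ωc i.Ac)) x l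
            *ᵥ fld (i.DΩ F μ *ᵥ (i.GΩ F *ᵥ f)) x' - fld (i.DΩ F μ *ᵥ (i.GΩ F *ᵥ f)) x)
        ≤ c₀ * (Real.exp (-(δ₀ * min (i.sdist1 x f) (i.sdist1 x' f))) * supN f) := this
      _ = c₀ * Real.exp (-(δ₀ * min (i.sdist1 x f) (i.sdist1 x' f))) * supN f := by ring
  ---------------------------------------------------------------- (1.10) on `Ω`
  · intro μ f x hR
    rcases hR with hR | hR
    · exact hR.elim
    obtain ⟨hfP, hφ⟩ := hsrc f
    clear Hm dV dD dH
    have hD0 : 0 ≤ i.sdist1 x f := i.sdist1_nonneg x f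
    have hb0 : 0 ≤ Real.exp (-(δ₀ * i.sdist1 x f)) * supN f := mul_nonneg (Real.exp_pos _).le (supN_nonneg f)
    have hR0 : 0 ≤ c₀ * Real.exp (-(δ₀ * i.sdist1 x f)) * supN f :=
      mul_nonneg (mul_nonneg hc₀0.le (Real.exp_pos _).le) (supN_nonneg f)
    refine ⟨?_, ?_⟩
    · show siteNorm (fld (i.DΩ F μ *ᵥ (i.GΩ F *ᵥ f)) x) ≤ c₀ * Real.exp (-(δ₀ * i.sdist1 x f)) * supN f
      by_cases hx : x.1 + e1 μ ∈ fineDom ((ℓ + 1) ^ i.k) i.Ωc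
      · have := hvec (fld (i.DΩ F μ *ᵥ (i.GΩ F *ᵥ f)) x) hb0 fun j => by
          rw [fld_apply]
          have h := Dm μ x hx (hlab x hR) (fun z => z ∈ i.supp f) (i.sdist1 x f * (((ℓ + 1) ^ i.k : ℕ) : ℝ))
            (mul_nonneg hD0 hnr.le) (hDs f x _ le_rfl) f hfP j
          rw [hexp1] at h
          calc |(i.DΩ F μ *ᵥ (i.GΩ F *ᵥ f)) (x, j)| ≤ C * Real.exp (-(δ₀ * i.sdist1 x f)) * ‖f‖ := h
            _ ≤ C * (Real.exp (-(δ₀ * i.sdist1 x f)) * supN f) := by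
                rw [mul_assoc]; exact mul_le_mul_of_nonneg_left (mul_le_mul_of_nonneg_left hφ (Real.exp_pos _).le) hC.le
        calc siteNorm (fld (i.DΩ F μ *ᵥ (i.GΩ F *ᵥ f)) x) ≤ c₀ * (Real.exp (-(δ₀ * i.sdist1 x f)) * supN f) := this
          _ = c₀ * Real.exp (-(δ₀ * i.sdist1 x f)) * supN f := by ring
      · rw [i.fld_DΩ_eq_zero F μ _ x hx, siteNorm_zero]
        exact hR0
    · show siteNorm (fld (i.GΩ F *ᵥ f) x) ≤ c₀ * Real.exp (-(δ₀ * i.sdist1 x f)) * supN f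
      have := hvec (fld (i.GΩ F *ᵥ f) x) hb0 fun j => by
        rw [fld_apply]
        have h := V x (hlab x hR) (fun z => z ∈ i.supp f) (i.sdist1 x f * (((ℓ + 1) ^ i.k : ℕ) : ℝ))
          (mul_nonneg hD0 hnr.le) (hDs f x _ le_rfl) f hfP j
        rw [hexp1] at h
        calc |(i.GΩ F *ᵥ f) (x, j)| ≤ C * Real.exp (-(δ₀ * i.sdist1 x f)) * ‖f‖ := h
          _ ≤ C * (Real.exp (-(δ₀ * i.sdist1 x f)) * supN f) := by
              rw [mul_assoc]; exact mul_le_mul_of_nonneg_left (mul_le_mul_of_nonneg_left hφ (Real.exp_pos _).le) hC.le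
      calc siteNorm (fld (i.GΩ F *ᵥ f) x) ≤ c₀ * (Real.exp (-(δ₀ * i.sdist1 x f)) * supN f) := this
        _ = c₀ * Real.exp (-(δ₀ * i.sdist1 x f)) * supN f := by ring
  ---------------------------------------------------------------- (1.9)·(1.12) for `δG`
  · intro μ f x x' hR
    rcases hR with hR | hR
    · exact hR.elim
    obtain ⟨hfP, hφ⟩ := hsrc f
    have hφE : ‖i.extR f‖ ≤ supN f := (i.norm_extR_le f).trans hφ
    have hres : (fun q : ↥(fineDom ((ℓ + 1) ^ i.k) i.Ωc) × ι => i.extR f (incl (Nat.one_le_pow i.k (ℓ + 1) (Nat.succ_pos ℓ)) i.hsub q.1, q.2)) = f :=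
      i.resR_extR f
    clear V Dm Hm dV dD
    show i.holderQ F α μ (i.DΩ F μ *ᵥ i.deltaV F f) x x'
      ≤ c₀ * Real.exp (-(δ₀ * min (i.sdist1 x f) (i.sdist1 x' f)))
        * Real.exp (-(δ₀ * min (i.cdist x) (i.cdist x') + δ₀ * i.bdistS f)) * supN f
    have hD0 : 0 ≤ min (i.sdist1 x f) (i.sdist1 x' f) := le_min (i.sdist1_nonneg x f) (i.sdist1_nonneg x' f)
    have hDb0 : 0 ≤ min (i.cdist x) (i.cdist x') := le_min (i.cdist_nonneg x) (i.cdist_nonneg x')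
    have hDf0 : 0 ≤ i.bdistS f := i.bdistS_nonneg f
    have hb0 : 0 ≤ Real.exp (-((min (i.cdist x) (i.cdist x') * (((ℓ + 1) ^ i.k : ℕ) : ℝ) + i.bdistS f * (((ℓ + 1) ^ i.k : ℕ) : ℝ)) / (4 * ((((ℓ + 1) ^ i.k : ℕ) : ℝ) * K)))) *
        Real.exp (-((min (i.sdist1 x f) (i.sdist1 x' f) * (((ℓ + 1) ^ i.k : ℕ) : ℝ)) / (4 * ((((ℓ + 1) ^ i.k : ℕ) : ℝ) * K)))) * supN f :=
      mul_nonneg (mul_nonneg (Real.exp_pos _).le (Real.exp_pos _).le) (supN_nonneg f)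
    rw [show c₀ * Real.exp (-(δ₀ * min (i.sdist1 x f) (i.sdist1 x' f)))
          * Real.exp (-(δ₀ * min (i.cdist x) (i.cdist x') + δ₀ * i.bdistS f)) * supN f
        = c₀ * (Real.exp (-((min (i.cdist x) (i.cdist x') * (((ℓ + 1) ^ i.k : ℕ) : ℝ) + i.bdistS f * (((ℓ + 1) ^ i.k : ℕ) : ℝ)) / (4 * ((((ℓ + 1) ^ i.k : ℕ) : ℝ) * K)))) *
        Real.exp (-((min (i.sdist1 x f) (i.sdist1 x' f) * (((ℓ + 1) ^ i.k : ℕ) : ℝ)) / (4 * ((((ℓ + 1) ^ i.k : ℕ) : ℝ) * K)))) * supN f) by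
          rw [hexp2]; ring]
    refine i.holderQ_le F (mul_nonneg hc₀0.le hb0) fun l hl => ?_
    obtain ⟨hx, hx', hne, hch, hend, hlen, hnear⟩ := hl
    have hw0 : 0 ≤ i.wt α x x' := Real.rpow_nonneg (div_nonneg hnr.le (supNorm_nonneg _)) α
    refine hvecw (i.wt α x x') _ hw0 hb0 fun j => ?_
    have h := dH μ x x' hx hx' hne l hch hend hlen hnear (hlab x (hR.trans (min_le_left _ _)))
      (hlab x' (hR.trans (min_le_right _ _))) (fun p => ∃ z ∈ i.supp f, incl (Nat.one_le_pow i.k (ℓ + 1) (Nat.succ_pos ℓ)) i.hsub z = p)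
      (min (i.sdist1 x f) (i.sdist1 x' f) * (((ℓ + 1) ^ i.k : ℕ) : ℝ))
      (min (i.cdist x) (i.cdist x') * (((ℓ + 1) ^ i.k : ℕ) : ℝ)) (i.bdistS f * (((ℓ + 1) ^ i.k : ℕ) : ℝ))
      (mul_nonneg hD0 hnr.le) (mul_nonneg hDb0 hnr.le) (mul_nonneg hDf0 hnr.le)
      (hDsE f x _ (min_le_left _ _)) (hDsE f x' _ (min_le_right _ _)) (hDb x _ (min_le_left _ _))
      (hDb x' _ (min_le_right _ _)) (hDf f) (i.extR f) (hsrcE f) j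
    rw [hres] at h
    have hid : ∀ z : ↥(fineDom ((ℓ + 1) ^ i.k) i.Ωc), z.1 + e1 μ ∈ fineDom ((ℓ + 1) ^ i.k) i.Ωc →
        fld (i.DΩ F μ *ᵥ i.deltaV F f) z = fld (i.DΩ F μ *ᵥ (i.GΩ F *ᵥ f)) z
          - fld (i.D₀ F μ *ᵥ (i.G₀ F *ᵥ i.extR f)) (incl (Nat.one_le_pow i.k (ℓ + 1) (Nat.succ_pos ℓ)) i.hsub z) := by
      intro z hz; funext j'; rw [Pi.sub_apply, i.fld_DΩ_deltaV_apply F μ f z hz j']; rfl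
    rw [hid x hx, hid x' hx', Matrix.mulVec_sub]
    have halg : transport (fieldLink F i.κ (acBond i.Ωc i.Ac)) x l *ᵥ fld (i.DΩ F μ *ᵥ (i.GΩ F *ᵥ f)) x'
          - transport (fieldLink F i.κ (acBond i.Ωc i.Ac)) x l *ᵥ fld (i.D₀ F μ *ᵥ (i.G₀ F *ᵥ i.extR f))
              (incl (Nat.one_le_pow i.k (ℓ + 1) (Nat.succ_pos ℓ)) i.hsub x')
          - (fld (i.DΩ F μ *ᵥ (i.GΩ F *ᵥ f)) x - fld (i.D₀ F μ *ᵥ (i.G₀ F *ᵥ i.extR f)) (incl (Nat.one_le_pow i.k (ℓ + 1) (Nat.succ_pos ℓ)) i.hsub x))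
        = transport (fieldLink F i.κ (acBond i.Ωc i.Ac)) x l *ᵥ fld (i.DΩ F μ *ᵥ (i.GΩ F *ᵥ f)) x'
          - fld (i.DΩ F μ *ᵥ (i.GΩ F *ᵥ f)) x
          - (transport (fieldLink F i.κ (acBond i.Ωc i.Ac)) x l *ᵥ fld (i.D₀ F μ *ᵥ (i.G₀ F *ᵥ i.extR f))
              (incl (Nat.one_le_pow i.k (ℓ + 1) (Nat.succ_pos ℓ)) i.hsub x') - fld (i.D₀ F μ *ᵥ (i.G₀ F *ᵥ i.extR f)) (incl (Nat.one_le_pow i.k (ℓ + 1) (Nat.succ_pos ℓ)) i.hsub x)) := by abel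
    rw [halg]
    refine h.trans ?_
    rw [mul_assoc C, mul_assoc C]
    exact mul_le_mul_of_nonneg_left (mul_le_mul_of_nonneg_left hφE (by positivity)) hC.le
  ---------------------------------------------------------------- (1.10)·(1.12) for `δG`
  · intro μ f x hR
    rcases hR with hR | hR
    · exact hR.elim
    obtain ⟨hfP, hφ⟩ := hsrc f
    have hφE : ‖i.extR f‖ ≤ supN f := (i.norm_extR_le f).trans hφ
    have hres : (fun q : ↥(fineDom ((ℓ + 1) ^ i.k) i.Ωc) × ι => i.extR f (incl (Nat.one_le_pow i.k (ℓ + 1) (Nat.succ_pos ℓ)) i.hsub q.1, q.2)) = f :=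
      i.resR_extR f
    clear V Dm Hm dH
    have hD0 : 0 ≤ i.sdist1 x f := i.sdist1_nonneg x f
    have hDb0 : 0 ≤ i.cdist x := i.cdist_nonneg x
    have hDf0 : 0 ≤ i.bdistS f := i.bdistS_nonneg f
    have hb0 : 0 ≤ Real.exp (-((i.cdist x * (((ℓ + 1) ^ i.k : ℕ) : ℝ) + i.bdistS f * (((ℓ + 1) ^ i.k : ℕ) : ℝ)) / (4 * ((((ℓ + 1) ^ i.k : ℕ) : ℝ) * K)))) *
        Real.exp (-((i.sdist1 x f * (((ℓ + 1) ^ i.k : ℕ) : ℝ)) / (4 * ((((ℓ + 1) ^ i.k : ℕ) : ℝ) * K)))) * supN f :=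
      mul_nonneg (mul_nonneg (Real.exp_pos _).le (Real.exp_pos _).le) (supN_nonneg f)
    have hRHS : c₀ * Real.exp (-(δ₀ * i.sdist1 x f)) * Real.exp (-(δ₀ * i.cdist x + δ₀ * i.bdistS f)) * supN f
        = c₀ * (Real.exp (-((i.cdist x * (((ℓ + 1) ^ i.k : ℕ) : ℝ) + i.bdistS f * (((ℓ + 1) ^ i.k : ℕ) : ℝ)) / (4 * ((((ℓ + 1) ^ i.k : ℕ) : ℝ) * K)))) *
          Real.exp (-((i.sdist1 x f * (((ℓ + 1) ^ i.k : ℕ) : ℝ)) / (4 * ((((ℓ + 1) ^ i.k : ℕ) : ℝ) * K)))) * supN f) := by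
      rw [hexp2]; ring
    have hfin : ∀ {t : ℝ}, t ≤ C * Real.exp (-((i.cdist x * (((ℓ + 1) ^ i.k : ℕ) : ℝ) + i.bdistS f * (((ℓ + 1) ^ i.k : ℕ) : ℝ)) / (4 * ((((ℓ + 1) ^ i.k : ℕ) : ℝ) * K)))) *
        Real.exp (-((i.sdist1 x f * (((ℓ + 1) ^ i.k : ℕ) : ℝ)) / (4 * ((((ℓ + 1) ^ i.k : ℕ) : ℝ) * K)))) * ‖i.extR f‖ →
        t ≤ C * (Real.exp (-((i.cdist x * (((ℓ + 1) ^ i.k : ℕ) : ℝ) + i.bdistS f * (((ℓ + 1) ^ i.k : ℕ) : ℝ)) / (4 * ((((ℓ + 1) ^ i.k : ℕ) : ℝ) * K)))) *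
        Real.exp (-((i.sdist1 x f * (((ℓ + 1) ^ i.k : ℕ) : ℝ)) / (4 * ((((ℓ + 1) ^ i.k : ℕ) : ℝ) * K)))) * supN f) := by
      intro t ht
      refine ht.trans ?_
      rw [mul_assoc C, mul_assoc C]
      exact mul_le_mul_of_nonneg_left (mul_le_mul_of_nonneg_left hφE (by positivity)) hC.le
    refine ⟨?_, ?_⟩
    · show siteNorm (fld (i.DΩ F μ *ᵥ i.deltaV F f) x)
        ≤ c₀ * Real.exp (-(δ₀ * i.sdist1 x f)) * Real.exp (-(δ₀ * i.cdist x + δ₀ * i.bdistS f)) * supN f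
      rw [hRHS]
      by_cases hx : x.1 + e1 μ ∈ fineDom ((ℓ + 1) ^ i.k) i.Ωc
      · refine hvec _ hb0 fun j => ?_
        have h := dD μ x hx (hlab x hR) (fun p => ∃ z ∈ i.supp f, incl (Nat.one_le_pow i.k (ℓ + 1) (Nat.succ_pos ℓ)) i.hsub z = p)
          (i.sdist1 x f * (((ℓ + 1) ^ i.k : ℕ) : ℝ)) (i.cdist x * (((ℓ + 1) ^ i.k : ℕ) : ℝ))
          (i.bdistS f * (((ℓ + 1) ^ i.k : ℕ) : ℝ)) (mul_nonneg hD0 hnr.le) (mul_nonneg hDb0 hnr.le)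
          (mul_nonneg hDf0 hnr.le) (hDsE f x _ le_rfl) (hDb x _ le_rfl) (hDf f)
          (i.extR f) (hsrcE f) j
        rw [hres] at h
        rw [i.fld_DΩ_deltaV_apply F μ f x hx j]
        exact hfin h
      · rw [i.fld_DΩ_eq_zero F μ _ x hx, siteNorm_zero]
        exact mul_nonneg hc₀0.le hb0
    · show siteNorm (fld (i.deltaV F f) x)
        ≤ c₀ * Real.exp (-(δ₀ * i.sdist1 x f)) * Real.exp (-(δ₀ * i.cdist x + δ₀ * i.bdistS f)) * supN f
      rw [hRHS]
      refine hvec _ hb0 fun j => ?_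
      have h := dV x (hlab x hR) (fun p => ∃ z ∈ i.supp f, incl (Nat.one_le_pow i.k (ℓ + 1) (Nat.succ_pos ℓ)) i.hsub z = p)
        (i.sdist1 x f * (((ℓ + 1) ^ i.k : ℕ) : ℝ)) (i.cdist x * (((ℓ + 1) ^ i.k : ℕ) : ℝ))
        (i.bdistS f * (((ℓ + 1) ^ i.k : ℕ) : ℝ)) (mul_nonneg hD0 hnr.le) (mul_nonneg hDb0 hnr.le)
        (mul_nonneg hDf0 hnr.le) (hDsE f x _ le_rfl) (hDb x _ le_rfl) (hDf f)
        (i.extR f) (hsrcE f) j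
      rw [hres] at h
      rw [i.fld_deltaV_apply F f x j]
      exact hfin h

/-! ## §4. (1.8) on the same family -/

/-- **(1.8) ON THE FAMILY** ((1.8) `−Δ^{η,N}_{A,Ω} + aP_k(A) ≥ γ₀I`; p. 573 «The constant γ₀ is independent of the lattice
spacing η, as well as of Ω and of A.»): for every block size `K`,
`Claim18Printed (regionPairFam … K)` — there are `γ₀, e₁ > 0` (`γ₀ = min(2, ¾a₋)/4`) such that every instance whose field
is (1.7)-regular on `Ω₀` with coupling `0 < e ≤ e₁` has `γ₀‖v‖² ≤ ⟨v, (−Δ^{η,N}_{A,Ω} + m² + a_kP_k(A))v⟩` on `Ω`; by the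
lineage's `B4Lower18RegularRegion.lower18_regular_region_printed` at the running coefficient `a_k ∈ [¾a₋, a₊]`
(`B4CubeFieldHyps22.aSeq_window`, threshold `cubeField_threshold`). [cite: Balaban1983RegularityDecay, (1.8) p.573] -/
theorem claim18Printed_regionPairFam (F : OrthFlow ι) {ℓ₁ : ℝ} (hℓ₁ : 0 ≤ ℓ₁)
    (hLip : ∀ t (v : ι → ℝ), ((F.U t - 1) *ᵥ v) ⬝ᵥ ((F.U t - 1) *ᵥ v) ≤ (ℓ₁ * t) ^ 2 * (v ⬝ᵥ v))
    (d ℓ : ℕ) (hℓ : 1 ≤ ℓ) (amin aplus m2plus : ℝ) (ha : 0 < amin) (creg β : ℝ) (hcreg : 0 ≤ creg)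
    (hβ : 0 < β) (K : ℕ) :
    B4.Claim18Printed (regionPairFam F d ℓ amin aplus m2plus creg β K) := by
  obtain ⟨e₁, he₁, h₁⟩ := B4CubeFieldHyps22.cubeField_threshold d (c := 0) (aplus := aplus) hℓ₁ le_rfl ha hcreg hβ 1 K
  refine ⟨min 2 (3 / 4 * amin) / 4, e₁, by positivity, he₁, ?_⟩
  intro i hreg he hle v
  dsimp only [regionPairFam] at hreg he hle ⊢
  obtain ⟨hak1, hak2⟩ := B4CubeFieldHyps22.aSeq_window hℓ i.hk ha i.ha1 i.ha2
  obtain ⟨_, hsm, _⟩ := h₁ i.e he hle _ hak1 hak2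
  have hsmall : ℓ₁ ^ 2 * (((d : ℝ) + 1) * creg * i.e ^ β) ^ 2 * ((d : ℝ) + 1)
      * (1 + B1.aSeq i.a ((ℓ : ℝ) + 1) i.k * ((d : ℝ) + 1)) ≤ min 2 (B1.aSeq i.a ((ℓ : ℝ) + 1) i.k) / 4 := by
    simpa only [Nat.cast_one, mul_one] using hsm
  have hak0 : 0 ≤ B1.aSeq i.a ((ℓ : ℝ) + 1) i.k := le_trans (by positivity) hak1
  have h17Ω : ∀ x ∈ fineDom ((ℓ + 1) ^ i.k) i.Ωc, ∀ μ ν : Fin (d + 1),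
      |i.Ac (x + e1 μ) ν - i.Ac x ν| ≤ creg * i.e ^ (β - 1) / ((ℓ + 1) ^ i.k : ℕ) :=
    fun x hx μ ν => hreg x (B4RegionCubeCarrier.fineDom_mono (Nat.one_le_pow i.k (ℓ + 1) (Nat.succ_pos ℓ)) i.hsub hx) μ ν
  have h := B4Lower18RegularRegion.lower18_regular_region_printed F hℓ₁ hLip he (Nat.one_le_pow i.k (ℓ + 1) (Nat.succ_pos ℓ)) hak0 i.m2 i.Ωc hcreg h17Ω
    hsmall v
  have hγ : min 2 (3 / 4 * amin) / 4 ≤ min 2 (B1.aSeq i.a ((ℓ : ℝ) + 1) i.k) / 4 + i.m2 := by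
    have : min 2 (3 / 4 * amin) ≤ min 2 (B1.aSeq i.a ((ℓ : ℝ) + 1) i.k) := min_le_min le_rfl hak1
    linarith [i.hm1]
  exact (mul_le_mul_of_nonneg_right hγ (dotProduct_self_nonneg' v)).trans h

end

end Literature.MathematicalPhysics.QuantumFieldTheory.Balaban1983to89.B4ThmRegionPairEta
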